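import Mathlib
import Literature.Combinatorics.Jukna2001.Counting
import Literature.Combinatorics.Extremal.DependentRandomChoice
import Literature.Combinatorics.Extremal.ZarankiewiczQuadrilateral

/-!
# Advanced Counting — Jukna, *Extremal Combinatorics* (2001), Chapter 2

Source: S. Jukna, *Extremal Combinatorics — With Applications in Computer Science*, first edition,
Springer 2001 [Jukna2001] (ISBN 3-540-66313-4; doi 10.1007/978-3-662-04650-0), Part I «The
Classics», Chapter 2 «Advanced Counting»: §2.1 Bounds on intersection size, §2.2 Zarankiewicz's
problem, §2.3 Density of 0-1 matrices, Exercises 2.1–2.17.  Held text: the store item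
`book:jukna2011-extremal-combinatorics-with-applications-computer-science`, whose bytes are the
FIRST edition (preface «Frankfurt/Vilnius, March 2001»), chunks p0035 l. 13 – p0043 l. 10
(Chapter 3 starts at p0043 l. 11).  As for Chapter 1 (`Counting.lean`), the held Contents page is
not legible for folios, so every cite tag below carries the item and the held chunk + line as its
binding locator, not a printed page.

## What is already in the tree or in Mathlib (cited by name, not restated)

* §2.2: Theorem 2.4 (Kővári–Sós–Turán 1954, `k_a(n) ≤ (a−1)^{1/a} n^{2−1/a} + (a−1)n`) =
  `Literature.Combinatorics.Extremal.kovari_sos_turan_square`, its star count («We may count the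
  stars S(x,B) in two ways») = `Literature.Combinatorics.Extremal.sum_card_powersetCard_neighbors`,
  (2.4)–(2.5) = `Literature.Combinatorics.Extremal.kovari_sos_turan_choose`, and Exercise 2.6 (the
  unbalanced `k_{a,b}(m,n)`) = `Literature.Combinatorics.Extremal.kovari_sos_turan` (all in
  `Extremal/KovariSosTuranTheorem.lean`, which cites this very chapter; it arrives transitively
  through the `ZarankiewiczQuadrilateral` import below — nothing typed here uses them).
* §2.1: the power count of Exercise 2.8, `Σ_{x} d(x)^s = Σ_{(i_1,…,i_s)} |A_{i_1} ∩ ⋯ ∩ A_{i_s}|`,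
  = `Literature.Combinatorics.Extremal.DependentRandomChoice.sum_card_tupleNbrs` (IMPORTED and
  used, at `R := (· ∈ A ·)`, in the hint route to Lemma 2.3); the identities (1.7)–(1.9) of
  Chapter 1 for a family given as a `Finset (Finset α)` = `Counting.prop_1_6`,
  `Counting.sum_degree_sq_eq`, `Counting.sum_sum_degree_eq_sum_sum_card_inter` — Lemmas 2.1–2.3
  are about SEQUENCES `A_1, …, A_N` (members may repeat), so the indexed forms are proved below as
  the steps of the printed proofs, citing those; (1.8), also at `Y = A_i` («By (1.8), we have for
  each i …»), = Mathlib's `Finset.sum_card_bipartiteAbove_eq_sum_card_bipartiteBelow` at the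
  relation `x ∈ A_j` (USED, not restated — the by-statement census closed the indexed form by it);
  the
  Cauchy–Schwarz / power-mean step (2.3) = Mathlib's `pow_sum_le_card_mul_sum_pow`
  (`sq_sum_le_card_mul_sum_sq`).  A Summits file
  (`Summits/QuantumAdvantage/CertifiedRandomness/ShallowQueryEntropyFloorReedSolomon.lean`) cites
  Lemma 2.1 for comparison only; its `card_filter_le_of_pairwise_inter_le` is a different
  statement (a second-order Bonferroni count of the kind behind Exercise 2.1, not Corrádi's
  lemma), and no Summits module is imported.
* §2.2, projective planes (Exercise 2.5): Mathlib's `Configuration.ProjectivePlane`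
  (`card_points`, `card_lines`, `pointCount_eq`, `lineCount_eq`,
  `Configuration.Nondegenerate.eq_or_eq`); the tree's
  `Literature.Combinatorics.Extremal.ZarankiewiczQuadrilateral.card_le_of_card_eq` (Reiman's
  bound `e ≤ ½ n (1 + √(4n − 3))` for `K(2,2)`-free `n × n` bipartite graphs — Theorem 2.4's case
  `a = 2` in its sharp form), `incidence_quadrilateral_free` / `card_incidence` /
  `card_incidence_eq_bound` (the incidence graph of a projective plane is `K(2,2)`-free, has
  `|P|(q+1)` edges, and attains Reiman's bound — the EQUALITY case of the Zarankiewicz bound, a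
  neighbour of Exercise 2.5's equality in (2.1), not the same statement; all cited) and
  `Literature.Combinatorics.Designs.ProjectivePlaneOverFiniteField.theorem_7_8` (existence of
  `PG(2,q)`; cited, not imported).  §2.2–2.3: the row double count `|E| = Σ_x d(x)` of a 0-1
  matrix / bipartite graph `E ⊆ V₁ × V₂` =
  `Literature.Combinatorics.Extremal.ZarankiewiczQuadrilateral.card_eq_sum_degree` (IMPORTED and
  used in Lemmas 2.7, 2.8 and Exercise 2.16 — the census closed the draft's row count by it; the
  column count is typed below).
* §2.3 and Exercises: Proposition 1.12 = `Counting.prop_1_12` (IMPORTED and used for Exercise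
  2.13); Jensen = `ConvexOn.map_sum_le` with `Real.convexOn_mul_log`; Hamming distance =
  Mathlib's `hammingDist` (Exercise 2.17); Exercise 2.4 is P. Frankl's union-closed sets
  conjecture — OPEN («Prove or give a counterexample … (Open conjecture, due to Peter Frankl)»):
  it is NOT a theorem and is neither stated nor given a `def` here (the tree's
  `Literature.Combinatorics.SetFamily.ReimerAverageSetSize.reimer_average_set_size` is Reimer's
  average-set-size theorem for union-closed families, a different statement).

## What is typed here (26 theorems, no definition, no named fact)

§2.1: the counts of the proof of Lemma 2.1 for indexed families (`sum_degree_eq` = (1.7),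
`sum_degree_sq_eq` = (1.9); (1.8) is Mathlib's, used), **Lemma 2.1** (Corrádi)
cleared of the division (`lemma_2_1`) and as printed (`lemma_2_1_div`), **Lemma 2.2** (`lemma_2_2`),
**Lemma 2.3** by the route of its hint = Exercises 2.8–2.9 with the hint's threshold `k(k−1)w^k`
(`lemma_2_3_of_hint`, its union bound `card_filter_not_injective_le`) and Lemma 2.3 for `k = 3`
with the printed threshold `6w³` (`lemma_2_3_three`).  §2.2: the column double count
`Σ_y d(y) = |E|` (`sum_card_col_eq_card`; the row count is the tree's, used), **Lemma 2.6**
(`lemma_2_6`) and **Theorem 2.5**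
(Ossowski; Galvin's proof) (`theorem_2_5`).  §2.3: **Lemma 2.7** (Grigni–Sipser) (`lemma_2_7`),
**Lemma 2.8** (Håstad) (`lemma_2_8`), **Corollary 2.9** (`corollary_2_9`).  Exercises: 2.1
(`exercise_2_1`, `exercise_2_1_aux`), 2.3 with its hint (`exercise_2_3`, `exercise_2_3_count`), 2.5
(`exercise_2_5_lines`, `exercise_2_5`), 2.11 both parts (`exercise_2_11`, `exercise_2_11_blocks`),
2.13 (`exercise_2_13`), 2.14 (`exercise_2_14`), 2.16 (`exercise_2_16`), 2.17 (Alon 1986)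
(`exercise_2_17`).

## Not typed, and why

Theorem 2.4, (2.4)–(2.5), Exercises 2.6 and 2.8 (in the tree, cited above); Lemma 2.3 with the
printed threshold `2k w^k` for `k ≥ 4` (the book leaves the proof to Exercises 2.8–2.9, whose route
gives `k(k−1) w^k`; the two agree for `k = 2, 3`, which are typed); Exercise 2.2 (Latin
transversals; not typed this pass), 2.4 (OPEN conjecture, see above), 2.7 (Paturi–Zane, an
induction on `r` over `r`-partite graphs; not typed this pass), 2.9 (it IS the proof of
`lemma_2_3_of_hint`), 2.10 and 2.12 (not typed this pass), 2.15 (hypothesis (ii) «the average size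
of their pairwise intersections does not exceed k» is ambiguous as printed — over ordered or
unordered pairs, with or without `i = j` — and the claimed bound changes with the reading; not
typed).

## Print readings recorded (words only; statements typed as meant)

Lemmas 2.2/2.3 are typed with `X ≠ ∅` (for `n = 0`, `w = 1/2`, `N = 1` the printed statement has
no pair `i ≠ j`); Exercise 2.3 counts ordered pairs with `A = B` allowed, the form its hint proves
(with «A ≠ B» the claim fails for `m = 2`); Exercise 2.10 prints «s ≤ (1 ε)αN» and «every every»
(a lost minus sign and a doubled word); Exercise 2.17 prints «d > n(1 1/C(k,2))» (read
`d > n(1 − 1/C(k,2))`); Theorem 2.5's «no isolated vertices» is not used by Galvin's proof for the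
conclusion as typed and is dropped; Lemma 2.6 is typed with the part of «no isolated vertices» the
proof uses (every `x ∈ X` has an edge); Exercise 2.16 needs `n > 0` (typed so); Exercise 2.11 is
typed for every real `b > 0` (the book's `1 ≤ b ≤ a` is not needed), and its second question («How
many elements of X belong to blocks of size at most ab?», printed without an answer) is answered at
the level of blocks — at least `(1 − 1/b)·m` blocks have size at most `ab` — since the number of
elements in such blocks has no positive lower bound in general.

## Design notes

Imports: `Mathlib`, `Literature.Combinatorics.Jukna2001.Counting` (Proposition 1.12, used in
Exercise 2.13), `Literature.Combinatorics.Extremal.DependentRandomChoice` (Exercise 2.8's power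
count, used in Lemma 2.3) and `Literature.Combinatorics.Extremal.ZarankiewiczQuadrilateral` (the
row double count, used in §2.3).  Set systems `A_1, …, A_N` are indexed families
`A : ι → Finset α` over `[Fintype ι]` inside a ground finset `X` (`A i ⊆ X`, `n = X.card`,
`N = Fintype.card ι`), degrees written inline as `(univ.filter (fun i => x ∈ A i)).card`; «average
size at least n/w» is `X.card / w ≤ (Σ_i |A_i|) / N` over `ℝ`.  A 0-1 matrix is the finset
`H : Finset (ι × κ)` of its 1-entries (`m = |ι|`, `n = |κ|`), a bipartite graph is
`E : Finset (V₁ × V₂)`, and densities are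
cleared of division (`a`-dense row `i`: `a·n ≤ #{j : (i,j) ∈ H}`); Håstad's lemma is over
`H : Finset (Π i, A i)`; strings of length `n` are `Fin n → α` with Mathlib's `hammingDist`;
projective planes are Mathlib's `Configuration.ProjectivePlane P L` (order `q`, lines as the
finsets `{p | p ∈ l}`).  No `instance`, no notation, no `def`.  HONEST FRAMING: shared numerical
engines serving client cells; rigour lives in the verifiers; every published number belongs to a
client cell's ledger, not to the engines group — this file is a Literature anchor typed at
statement granularity from the held text, with every public declaration cite-tagged to its item
and held chunk.
-/

namespace Literature.Combinatorics.Jukna2001.AdvancedCounting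

open Finset

section IntersectionSize

variable {α ι : Type*} [DecidableEq α] [Fintype ι]

/-- The identity (1.7) for an indexed family `A : ι → Finset α` of subsets of `X` (members may
repeat): `Σ_{x ∈ X} d(x) = Σ_i |A_i|`, the first count of the proof of Lemma 2.1 (Chapter 1's
`Counting.prop_1_6` is the same identity for a family given as a `Finset` of distinct sets).
[cite: Jukna2001, Ch. 2 §2.1, proof of Lemma 2.1 (the step
`(Σ_i |A_i|)² / |X| = (Nr)² / |X|`); held p0035 l. 25 – p0036 l. 6] -/
theorem sum_degree_eq (A : ι → Finset α) (X : Finset α) (hX : ∀ i, A i ⊆ X) :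
    ∑ x ∈ X, (univ.filter (fun i => x ∈ A i)).card = ∑ i, (A i).card := by
  have h := Finset.sum_card_bipartiteAbove_eq_sum_card_bipartiteBelow
    (s := X) (t := (univ : Finset ι)) (fun x i => x ∈ A i)
  simp only [Finset.bipartiteAbove, Finset.bipartiteBelow] at h
  rw [h]
  refine sum_congr rfl (fun i _ => ?_)
  congr 1
  ext x
  simp only [mem_filter]
  exact ⟨fun hx => hx.2, fun hx => ⟨hX i hx, hx⟩⟩

/-- The identity (1.9) for an indexed family of subsets of `X`:
`Σ_{x ∈ X} d(x)² = Σ_i Σ_j |A_i ∩ A_j|` (ordered pairs, `i = j` included), the double count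
behind Lemmas 2.1–2.3 (Chapter 1's `Counting.sum_degree_sq_eq` is the `Finset`-family form).
[cite: Jukna2001, Ch. 2 §2.1, proofs of Lemmas 2.1 and 2.2 («using (1.8) and (1.9)»);
held p0035 l. 25 – p0036 l. 37] -/
theorem sum_degree_sq_eq (A : ι → Finset α) (X : Finset α) (hX : ∀ i, A i ⊆ X) :
    ∑ x ∈ X, (univ.filter (fun i => x ∈ A i)).card ^ 2 = ∑ i, ∑ j, (A i ∩ A j).card := by
  have h1 : ∀ x ∈ X, (univ.filter (fun i => x ∈ A i)).card ^ 2
      = ∑ i, if x ∈ A i then (univ.filter (fun i => x ∈ A i)).card else 0 := by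
    intro x _
    rw [← Finset.sum_filter, Finset.sum_const, smul_eq_mul, sq]
  rw [Finset.sum_congr rfl h1, Finset.sum_comm]
  refine sum_congr rfl (fun i _ => ?_)
  rw [← Finset.sum_filter]
  have h2 : X.filter (fun x => x ∈ A i) = A i := by
    ext x
    simp only [mem_filter]
    exact ⟨fun hx => hx.2, fun hx => ⟨hX i hx, hx⟩⟩
  rw [h2]
  -- (1.8) at `Y = A_i`: Mathlib's bipartite double count, at the relation `x ∈ A_j`
  exact Finset.sum_card_bipartiteAbove_eq_sum_card_bipartiteBelow (fun x j => x ∈ A j)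

/-- **Lemma 2.1** (Corrádi 1969), cleared of the division: if `A_1, …, A_N ⊆ X` are `r`-element sets
with `|A_i ∩ A_j| ≤ k` for `i ≠ j`, then `r² N ≤ |X| · (r + (N − 1) k)` — (2.1) reads
`|X| ≥ r²N / (r + (N−1)k)`; `X` may be any finset containing the members (the book takes the union,
which gives the strongest instance).
[cite: Jukna2001, Ch. 2 §2.1, Lemma 2.1 (2.1); held p0035 l. 21–23] -/
theorem lemma_2_1 [DecidableEq ι] (A : ι → Finset α) (X : Finset α) (hX : ∀ i, A i ⊆ X)
    {r k : ℕ}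
    (hr : ∀ i, (A i).card = r) (hk : ∀ i j, i ≠ j → (A i ∩ A j).card ≤ k) :
    r ^ 2 * Fintype.card ι ≤ X.card * (r + (Fintype.card ι - 1) * k) := by
  set N := Fintype.card ι with hNdef
  set d : α → ℕ := fun x => (univ.filter (fun i => x ∈ A i)).card with hddef
  have h1 : ∑ x ∈ X, d x = N * r := by
    simp only [hddef]
    rw [sum_degree_eq A X hX]
    simp [hr, hNdef]
  have hrow : ∀ i, ∑ j, (A i ∩ A j).card ≤ r + (N - 1) * k := by
    intro i
    rw [← Finset.add_sum_erase (univ : Finset ι) (fun j => (A i ∩ A j).card) (mem_univ i)]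
    have hself : (A i ∩ A i).card = r := by rw [inter_self, hr]
    have hrest : ∑ j ∈ univ.erase i, (A i ∩ A j).card ≤ (univ.erase i).card • k :=
      Finset.sum_le_card_nsmul _ _ _ (fun j hj => hk i j (fun h => (mem_erase.1 hj).1 h.symm))
    rw [card_erase_of_mem (mem_univ i), card_univ, smul_eq_mul] at hrest
    simp only [hself]
    exact Nat.add_le_add_left hrest r
  have h2 : ∑ x ∈ X, d x ^ 2 ≤ N * (r + (N - 1) * k) := by
    simp only [hddef]
    rw [sum_degree_sq_eq A X hX]
    calc ∑ i, ∑ j, (A i ∩ A j).card ≤ ∑ _i : ι, (r + (N - 1) * k) :=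
          sum_le_sum (fun i _ => hrow i)
      _ = N * (r + (N - 1) * k) := by simp [hNdef]
  have hCS : (∑ x ∈ X, d x) ^ 2 ≤ X.card * ∑ x ∈ X, d x ^ 2 := sq_sum_le_card_mul_sum_sq
  rw [h1] at hCS
  rcases Nat.eq_zero_or_pos N with hN0 | hNpos
  · simp [hN0]
  · have key : N * (r ^ 2 * N) ≤ N * (X.card * (r + (N - 1) * k)) := by
      calc N * (r ^ 2 * N) = (N * r) ^ 2 := by ring
        _ ≤ X.card * ∑ x ∈ X, d x ^ 2 := hCS
        _ ≤ X.card * (N * (r + (N - 1) * k)) := Nat.mul_le_mul_left _ h2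
        _ = N * (X.card * (r + (N - 1) * k)) := by ring
    exact Nat.le_of_mul_le_mul_left key hNpos

/-- **Lemma 2.1** (2.1) as printed, with the division over `ℝ`: `r² N / (r + (N − 1) k) ≤ |X|`.
[cite: Jukna2001, Ch. 2 §2.1, Lemma 2.1 (2.1); held p0035 l. 21–23] -/
theorem lemma_2_1_div [DecidableEq ι] (A : ι → Finset α) (X : Finset α) (hX : ∀ i, A i ⊆ X)
    {r k : ℕ}
    (hr : ∀ i, (A i).card = r) (hk : ∀ i j, i ≠ j → (A i ∩ A j).card ≤ k) :
    (r : ℝ) ^ 2 * Fintype.card ι / (r + ((Fintype.card ι : ℝ) - 1) * k) ≤ X.card := by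
  set N := Fintype.card ι with hNdef
  rcases Nat.eq_zero_or_pos N with hN0 | hNpos
  · simp [hN0]
  have key := lemma_2_1 A X hX hr hk
  rw [← hNdef] at key
  have hcast : ((N - 1 : ℕ) : ℝ) = (N : ℝ) - 1 := Nat.cast_pred hNpos
  have key' : (r : ℝ) ^ 2 * N ≤ X.card * (r + ((N : ℝ) - 1) * k) := by
    rw [← hcast]
    exact_mod_cast key
  have hD : 0 ≤ (r : ℝ) + ((N : ℝ) - 1) * k := by
    rw [← hcast]; positivity
  rcases hD.eq_or_lt with hD0 | hDpos
  · rw [← hD0]; simp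
  · rw [div_le_iff₀ hDpos]
    linarith [key']

/-- Union bound used on the hint route to Lemma 2.3 (Exercise 2.9, «the argument of Lemma 2.2» for
`k`-tuples): the non-injective strings `Fin k → ι` number at most `C(k,2) · |ι|^(k−1)` (one pair of
equal coordinates fixed, the rest free).
[cite: Jukna2001, Ch. 2 §2.1, Exercise 2.9 (the argument of Lemma 2.2 for k-tuples);
held p0036 l. 32–37, p0041 l. 21] -/
theorem card_filter_not_injective_le (ι : Type*) [Fintype ι] [DecidableEq ι] (k : ℕ) :
    ((Finset.univ : Finset (Fin k → ι)).filter (fun f => ¬ Function.Injective f)).card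
      ≤ k.choose 2 * Fintype.card ι ^ (k - 1) := by
  classical
  cases k with
  | zero =>
    have h0 : (Finset.univ : Finset (Fin 0 → ι)).filter (fun f => ¬ Function.Injective f) = ∅ := by
      ext f
      simp only [mem_filter, mem_univ, true_and, Finset.notMem_empty, iff_false, not_not]
      exact Function.injective_of_subsingleton f
    rw [h0, card_empty]
    exact Nat.zero_le _
  | succ m =>
    set N := Fintype.card ι with hNdef
    have hcover : ((univ : Finset (Fin (m + 1) → ι)).filter (fun f => ¬ Function.Injective f))
        ⊆ ((univ : Finset (Fin (m + 1))).powersetCard 2).biUnion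
          (fun s => univ.filter
            (fun f : Fin (m + 1) → ι => ∃ i ∈ s, ∃ j ∈ s, i ≠ j ∧ f i = f j)) := by
      intro f hf
      simp only [mem_filter, mem_univ, true_and] at hf
      rw [Function.Injective] at hf
      push Not at hf
      obtain ⟨i, j, hij, hne⟩ := hf
      simp only [mem_biUnion, mem_powersetCard, mem_filter, mem_univ, true_and]
      exact ⟨{i, j}, ⟨subset_univ _, card_pair hne⟩, i, by simp, j, by simp, hne, hij⟩
    have hpiece : ∀ s ∈ (univ : Finset (Fin (m + 1))).powersetCard 2,
        (univ.filter (fun f : Fin (m + 1) → ι => ∃ i ∈ s, ∃ j ∈ s, i ≠ j ∧ f i = f j)).card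
          ≤ N ^ m := by
      intro s hs
      rw [mem_powersetCard] at hs
      obtain ⟨i, j, hne, rfl⟩ := card_eq_two.mp hs.2
      obtain ⟨p, hp⟩ := Fin.exists_succAbove_eq hne
      let ext : (Fin m → ι) → (Fin (m + 1) → ι) :=
        fun g => Fin.insertNth (α := fun _ => ι) j (g p) g
      have hsub : (univ.filter (fun f : Fin (m + 1) → ι =>
          ∃ i' ∈ ({i, j} : Finset (Fin (m + 1))), ∃ j' ∈ ({i, j} : Finset (Fin (m + 1))),
            i' ≠ j' ∧ f i' = f j')) ⊆ univ.image ext := by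
        intro f hf
        simp only [mem_filter, mem_univ, true_and, mem_insert, mem_singleton] at hf
        obtain ⟨i', hi', j', hj', hne', heq⟩ := hf
        have hfij : f i = f j := by
          rcases hi' with rfl | rfl <;> rcases hj' with rfl | rfl
          · exact absurd rfl hne'
          · exact heq
          · exact heq.symm
          · exact absurd rfl hne'
        rw [mem_image]
        refine ⟨Fin.removeNth (α := fun _ => ι) j f, mem_univ _, ?_⟩
        have hval : (Fin.removeNth (α := fun _ => ι) j f) p = f j := by
          show f (j.succAbove p) = f j
          rw [hp, hfij]
        show Fin.insertNth (α := fun _ => ι) j ((Fin.removeNth (α := fun _ => ι) j f) p)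
            (Fin.removeNth (α := fun _ => ι) j f) = f
        rw [hval]
        exact Fin.insertNth_self_removeNth j f
      calc _ ≤ (univ.image ext).card := card_le_card hsub
        _ ≤ (univ : Finset (Fin m → ι)).card := card_image_le
        _ = N ^ m := by simp [hNdef]
    calc _ ≤ (((univ : Finset (Fin (m + 1))).powersetCard 2).biUnion
            (fun s => univ.filter
              (fun f : Fin (m + 1) → ι => ∃ i ∈ s, ∃ j ∈ s, i ≠ j ∧ f i = f j))).card :=
          card_le_card hcover
      _ ≤ ∑ s ∈ (univ : Finset (Fin (m + 1))).powersetCard 2,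
            (univ.filter (fun f : Fin (m + 1) → ι => ∃ i ∈ s, ∃ j ∈ s, i ≠ j ∧ f i = f j)).card :=
          card_biUnion_le
      _ ≤ ∑ _s ∈ (univ : Finset (Fin (m + 1))).powersetCard 2, N ^ m := sum_le_sum hpiece
      _ = (m + 1).choose 2 * N ^ (m + 1 - 1) := by
          rw [sum_const, card_powersetCard, card_univ, Fintype.card_fin, smul_eq_mul]
          simp

/-- **Lemma 2.3** (Erdős 1964b) by the route of its hint (Exercises 2.8 and 2.9: the power count
`Σ_x d(x)^k = Σ_{(i_1,…,i_k)} |A_{i_1} ∩ ⋯ ∩ A_{i_k}|` of Exercise 2.8 — the tree's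
`Literature.Combinatorics.Extremal.DependentRandomChoice.sum_card_tupleNbrs`, cited, used — plus
Jensen and the argument of Lemma 2.2): subsets `A_i ⊆ X`, `X ≠ ∅`, of average size at least
`n/w`; if `N ≥ k(k−1)·w^k` then some `k` members WITH DISTINCT INDICES share at least `n/(2w^k)`
elements.  The printed threshold is
`N ≥ 2k w^k`; the hint's route gives `k(k−1) w^k`, which is the printed one for `k = 2, 3` and
weaker for `k ≥ 4` (the printed constant for `k ≥ 4` is not typed).
[cite: Jukna2001, Ch. 2 §2.1, Lemma 2.3 with Exercises 2.8–2.9;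
held p0036 l. 41–43, p0041 l. 15–21] -/
theorem lemma_2_3_of_hint [DecidableEq ι] (A : ι → Finset α) (X : Finset α) (hX : ∀ i, A i ⊆ X)
    (hn : X.Nonempty)
    {w : ℝ} (hw : 0 < w) {k : ℕ} (hk : 2 ≤ k)
    (havg : (X.card : ℝ) / w ≤ (∑ i, ((A i).card : ℝ)) / Fintype.card ι)
    (hN : (k : ℝ) * (k - 1) * w ^ k ≤ Fintype.card ι) :
    ∃ f : Fin k → ι, Function.Injective f ∧
      (X.card : ℝ) / (2 * w ^ k) ≤ ((X.filter (fun x => ∀ j, x ∈ A (f j))).card : ℝ) := by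
  classical
  by_contra hcon
  push Not at hcon
  set N := Fintype.card ι with hNdef
  set d : α → ℕ := fun x => (univ.filter (fun i => x ∈ A i)).card with hddef
  set F : (Fin k → ι) → Finset α := fun T => X.filter (fun x => ∀ j, x ∈ A (T j)) with hFdef
  have hk1 : 1 ≤ k := le_trans (by norm_num) hk
  have hkk : (0 : ℝ) < (k : ℝ) * (k - 1) := by
    have : (2 : ℝ) ≤ k := by exact_mod_cast hk
    nlinarith
  have hW : (0 : ℝ) < w ^ k := pow_pos hw k
  have hNpos : (0 : ℝ) < N := lt_of_lt_of_le (mul_pos hkk hW) hN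
  have hNpos' : 0 < N := by exact_mod_cast hNpos
  have hnr : (0 : ℝ) < X.card := by exact_mod_cast hn.card_pos
  -- Step A: the tuple double count (Exercise 2.8, cited from the tree)
  have hS : ∑ T : Fin k → ι, (F T).card = ∑ x ∈ X, d x ^ k := by
    have h := Literature.Combinatorics.Extremal.DependentRandomChoice.sum_card_tupleNbrs
      X (univ : Finset ι) (fun x i => x ∈ A i) k
    rw [Fintype.piFinset_univ] at h
    simpa [Literature.Combinatorics.Extremal.DependentRandomChoice.tupleNbrs, hFdef, hddef] using h
  -- Step B: power mean
  have hsumd : (N : ℝ) * X.card / w ≤ ∑ x ∈ X, (d x : ℝ) := by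
    have h1 : (∑ x ∈ X, (d x : ℝ)) = ∑ i, ((A i).card : ℝ) := by
      simp only [hddef]
      exact_mod_cast sum_degree_eq A X hX
    rw [h1]
    rw [le_div_iff₀ hNpos] at havg
    calc (N : ℝ) * X.card / w = X.card / w * N := by ring
      _ ≤ ∑ i, ((A i).card : ℝ) := havg
  have hLB : (X.card : ℝ) * (N : ℝ) ^ k ≤ w ^ k * ∑ x ∈ X, ((d x : ℝ)) ^ k := by
    obtain ⟨m, hm⟩ : ∃ m, k = m + 1 := ⟨k - 1, by omega⟩
    have hpm := pow_sum_le_card_mul_sum_pow (s := X) (f := fun x => (d x : ℝ))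
      (fun x _ => by positivity) m
    rw [← hm] at hpm
    -- (N n / w)^k ≤ (∑ d)^k ≤ n^(k-1) ∑ d^k
    have hpow : ((N : ℝ) * X.card / w) ^ k ≤ (∑ x ∈ X, (d x : ℝ)) ^ k :=
      pow_le_pow_left₀ (by positivity) hsumd k
    have hL : ((N : ℝ) * X.card / w) ^ k * w ^ k = (X.card : ℝ) ^ m * (X.card * (N : ℝ) ^ k) := by
      rw [div_pow, div_mul_cancel₀ _ (ne_of_gt hW), mul_pow, hm]
      ring
    have hnm : (0 : ℝ) < (X.card : ℝ) ^ m := by positivity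
    have : (X.card : ℝ) ^ m * (X.card * (N : ℝ) ^ k)
        ≤ (X.card : ℝ) ^ m * (w ^ k * ∑ x ∈ X, (d x : ℝ) ^ k) := by
      calc (X.card : ℝ) ^ m * (X.card * (N : ℝ) ^ k) = ((N : ℝ) * X.card / w) ^ k * w ^ k := hL.symm
        _ ≤ (∑ x ∈ X, (d x : ℝ)) ^ k * w ^ k := mul_le_mul_of_nonneg_right hpow hW.le
        _ ≤ ((X.card : ℝ) ^ m * ∑ x ∈ X, (d x : ℝ) ^ k) * w ^ k :=
            mul_le_mul_of_nonneg_right hpm hW.le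
        _ = (X.card : ℝ) ^ m * (w ^ k * ∑ x ∈ X, (d x : ℝ) ^ k) := by ring
    exact le_of_mul_le_mul_left this hnm
  -- Step C: upper bound via injective / non-injective split
  set Inj := (univ : Finset (Fin k → ι)).filter (fun T => Function.Injective T) with hInjdef
  set Non := (univ : Finset (Fin k → ι)).filter (fun T => ¬ Function.Injective T) with hNondef
  have hsplit : (∑ T : Fin k → ι, ((F T).card : ℝ))
      = ∑ T ∈ Inj, ((F T).card : ℝ) + ∑ T ∈ Non, ((F T).card : ℝ) :=
    (Finset.sum_filter_add_sum_filter_not univ (fun T => Function.Injective T) _).symm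
  have hInj : 2 * w ^ k * ∑ T ∈ Inj, ((F T).card : ℝ) ≤ Inj.card * X.card := by
    have h1 : ∀ T ∈ Inj, 2 * w ^ k * ((F T).card : ℝ) ≤ X.card := by
      intro T hT
      have hT' : Function.Injective T := (mem_filter.1 hT).2
      have := hcon T hT'
      rw [lt_div_iff₀ (by positivity)] at this
      linarith
    have := Finset.sum_le_card_nsmul Inj (fun T => 2 * w ^ k * ((F T).card : ℝ)) _ h1
    rw [← Finset.mul_sum, nsmul_eq_mul] at this
    exact this
  have hNon : ∑ T ∈ Non, ((F T).card : ℝ) ≤ Non.card * X.card := by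
    have h1 : ∀ T ∈ Non, ((F T).card : ℝ) ≤ X.card := by
      intro T _
      exact_mod_cast card_filter_le _ _
    have := Finset.sum_le_card_nsmul Non (fun T => ((F T).card : ℝ)) _ h1
    rw [nsmul_eq_mul] at this
    exact this
  have hNonle : (Non.card : ℝ) ≤ (k.choose 2 : ℝ) * (N : ℝ) ^ (k - 1) := by
    exact_mod_cast card_filter_not_injective_le ι k
  have hNon1 : (1 : ℝ) ≤ Non.card := by
    obtain ⟨i₀⟩ : Nonempty ι := Fintype.card_pos_iff.mp hNpos'
    have hmem : (fun _ : Fin k => i₀) ∈ Non := by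
      rw [hNondef, mem_filter]
      refine ⟨mem_univ _, fun hinj => ?_⟩
      have := @hinj ⟨0, by omega⟩ ⟨1, by omega⟩ rfl
      simp [Fin.ext_iff] at this
    exact_mod_cast card_pos.mpr ⟨_, hmem⟩
  have hInjle : (Inj.card : ℝ) ≤ (N : ℝ) ^ k - 1 := by
    have hsum : Inj.card + Non.card = N ^ k := by
      rw [hInjdef, hNondef, Finset.card_filter_add_card_filter_not, card_univ, Fintype.card_fun,
        Fintype.card_fin]
    have : (Inj.card : ℝ) + Non.card = (N : ℝ) ^ k := by exact_mod_cast hsum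
    linarith
  have h2c : (k.choose 2 : ℝ) * 2 = (k : ℝ) * (k - 1) := by
    have h := Nat.add_one_mul_choose_eq (k - 1) 1
    rw [Nat.choose_one_right, Nat.sub_add_cancel hk1] at h
    have hc : ((k - 1 : ℕ) : ℝ) = (k : ℝ) - 1 := Nat.cast_pred hk1
    rw [← hc]
    exact_mod_cast h.symm
  have hpowk : (N : ℝ) ^ k = N * (N : ℝ) ^ (k - 1) := by
    rw [← pow_succ', Nat.sub_add_cancel hk1]
  have hP0 : (0 : ℝ) ≤ (N : ℝ) ^ (k - 1) := by positivity
  -- assemble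
  have hS' : (∑ T : Fin k → ι, ((F T).card : ℝ)) = ∑ x ∈ X, ((d x : ℝ)) ^ k := by
    exact_mod_cast hS
  have u1 : 2 * w ^ k * ∑ x ∈ X, ((d x : ℝ)) ^ k
      ≤ Inj.card * X.card + 2 * w ^ k * (Non.card * X.card) := by
    rw [← hS', hsplit, mul_add]
    have : 2 * w ^ k * ∑ T ∈ Non, ((F T).card : ℝ) ≤ 2 * w ^ k * (Non.card * X.card) :=
      mul_le_mul_of_nonneg_left hNon (by positivity)
    linarith
  have u2 : (Inj.card : ℝ) * X.card ≤ ((N : ℝ) ^ k - 1) * X.card :=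
    mul_le_mul_of_nonneg_right hInjle hnr.le
  have u3 : 2 * w ^ k * ((Non.card : ℝ) * X.card)
      ≤ 2 * w ^ k * ((k.choose 2 : ℝ) * (N : ℝ) ^ (k - 1) * X.card) :=
    mul_le_mul_of_nonneg_left (mul_le_mul_of_nonneg_right hNonle hnr.le) (by positivity)
  have u4 : 2 * w ^ k * ((k.choose 2 : ℝ) * (N : ℝ) ^ (k - 1) * X.card)
      = ((k : ℝ) * (k - 1) * w ^ k) * (N : ℝ) ^ (k - 1) * X.card := by
    rw [← h2c]; ring
  have u5 : ((k : ℝ) * (k - 1) * w ^ k) * (N : ℝ) ^ (k - 1) * X.card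
      ≤ (N : ℝ) * (N : ℝ) ^ (k - 1) * X.card :=
    mul_le_mul_of_nonneg_right (mul_le_mul_of_nonneg_right hN hP0) hnr.le
  have l1 : 2 * ((X.card : ℝ) * (N : ℝ) ^ k) ≤ 2 * w ^ k * ∑ x ∈ X, ((d x : ℝ)) ^ k := by
    linarith [hLB]
  rw [hpowk] at l1 u2
  nlinarith [l1, u1, u2, u3, u4, u5, hnr]

/-- **Lemma 2.2**: subsets `A_1, …, A_N` of an `n`-element set `X ≠ ∅` of average size at least
`n/w`; if `N ≥ 2w²` then `|A_i ∩ A_j| ≥ n/(2w²)` for some `i ≠ j` — (2.2).  (`X ≠ ∅` is needed: for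
`n = 0`, `w = 1/2`, `N = 1` the printed statement has no pair `i ≠ j`.)
[cite: Jukna2001, Ch. 2 §2.1, Lemma 2.2 (2.2)–(2.3); held p0036 l. 20–37] -/
theorem lemma_2_2 [DecidableEq ι] (A : ι → Finset α) (X : Finset α) (hX : ∀ i, A i ⊆ X)
    (hn : X.Nonempty)
    {w : ℝ} (hw : 0 < w)
    (havg : (X.card : ℝ) / w ≤ (∑ i, ((A i).card : ℝ)) / Fintype.card ι)
    (hN : 2 * w ^ 2 ≤ Fintype.card ι) :
    ∃ i j, i ≠ j ∧ (X.card : ℝ) / (2 * w ^ 2) ≤ ((A i ∩ A j).card : ℝ) := by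
  have hN' : ((2 : ℕ) : ℝ) * ((2 : ℕ) - 1) * w ^ 2 ≤ Fintype.card ι := by norm_num; linarith
  obtain ⟨f, hf, hle⟩ := lemma_2_3_of_hint A X hX hn hw (k := 2) le_rfl havg hN'
  refine ⟨f 0, f 1, fun h => absurd (hf h) (by decide), ?_⟩
  have hset : X.filter (fun x => ∀ j : Fin 2, x ∈ A (f j)) = A (f 0) ∩ A (f 1) := by
    ext x
    simp only [mem_filter, mem_inter, Fin.forall_fin_two]
    exact ⟨fun h => h.2, fun h => ⟨hX _ h.1, h⟩⟩
  rw [hset] at hle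
  exact hle

/-- **Lemma 2.3** (Erdős 1964b) for `k = 3`, with the printed threshold `N ≥ 2·3·w³`: three members
with distinct indices share at least `n/(2w³)` elements.
[cite: Jukna2001, Ch. 2 §2.1, Lemma 2.3; held p0036 l. 41–43] -/
theorem lemma_2_3_three [DecidableEq ι] (A : ι → Finset α) (X : Finset α) (hX : ∀ i, A i ⊆ X)
    (hn : X.Nonempty)
    {w : ℝ} (hw : 0 < w)
    (havg : (X.card : ℝ) / w ≤ (∑ i, ((A i).card : ℝ)) / Fintype.card ι)
    (hN : 2 * 3 * w ^ 3 ≤ Fintype.card ι) :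
    ∃ i₁ i₂ i₃, i₁ ≠ i₂ ∧ i₁ ≠ i₃ ∧ i₂ ≠ i₃ ∧
      (X.card : ℝ) / (2 * w ^ 3) ≤ ((A i₁ ∩ A i₂ ∩ A i₃).card : ℝ) := by
  have hN' : ((3 : ℕ) : ℝ) * ((3 : ℕ) - 1) * w ^ 3 ≤ Fintype.card ι := by norm_num; linarith
  obtain ⟨f, hf, hle⟩ := lemma_2_3_of_hint A X hX hn hw (k := 3) (by norm_num) havg hN'
  refine ⟨f 0, f 1, f 2, fun h => absurd (hf h) (by decide), fun h => absurd (hf h) (by decide),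
    fun h => absurd (hf h) (by decide), ?_⟩
  have hset : X.filter (fun x => ∀ j : Fin 3, x ∈ A (f j)) = A (f 0) ∩ A (f 1) ∩ A (f 2) := by
    ext x
    simp only [mem_filter, mem_inter, Fin.forall_iff, Nat.lt_succ_iff]
    constructor
    · intro h
      exact ⟨⟨h.2 0 (by norm_num), h.2 1 (by norm_num)⟩, h.2 2 (by norm_num)⟩
    · intro h
      refine ⟨hX _ h.2, fun i hi => ?_⟩
      interval_cases i
      · exact h.1.1
      · exact h.1.2
      · exact h.2
  rw [hset] at hle
  exact hle

end IntersectionSize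


section Bipartite

variable {V₁ V₂ : Type*} [Fintype V₁] [Fintype V₂] [DecidableEq V₁] [DecidableEq V₂]

/-- Double counting of the edges of a bipartite graph `E ⊆ V₁ × V₂` (the 1-entries of a 0-1 matrix)
by right endpoints, `Σ_y d(y) = |E|` — the step `|X| ≤ Σ_y f(y) = (1/r) Σ_y |N(y)| = |E|/r < k + 1`
of Galvin's proof of Theorem 2.5 (the count by left endpoints is the tree's
`Literature.Combinatorics.Extremal.ZarankiewiczQuadrilateral.card_eq_sum_degree`, cited and used).
[cite: Jukna2001, Ch. 2 §2.2, proof of Theorem 2.5 (the display at l. 29);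
held p0038 l. 11–29] -/
theorem sum_card_col_eq_card (E : Finset (V₁ × V₂)) :
    ∑ y, (univ.filter (fun x => (x, y) ∈ E)).card = E.card := by
  rw [card_eq_sum_card_fiberwise (f := Prod.snd) (s := E) (t := (univ : Finset V₂))
    (fun e _ => by simp)]
  refine sum_congr rfl (fun y _ => ?_)
  apply card_nbij' (fun x => (x, y)) (fun e => e.1)
  · intro x hx
    simp only [coe_filter, mem_univ, true_and, Set.mem_setOf_eq] at hx ⊢
    exact ⟨hx, trivial⟩
  · intro e he
    simp only [coe_filter, mem_univ, true_and, Set.mem_setOf_eq] at he ⊢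
    obtain ⟨he1, he2⟩ := he
    rw [← he2]
    exact he1
  · intro x _
    rfl
  · intro e he
    simp only [coe_filter, Set.mem_setOf_eq] at he
    obtain ⟨_, he2⟩ := he
    rw [← he2]

end Bipartite

section Zarankiewicz

/-- **Lemma 2.6**: a bipartite graph `(X, Y, E)` and `f : Y → [0, ∞)` with `d(y) ≤ d(x)·f(y)` on
every edge `(x, y) ∈ E`; then `|X| ≤ Σ_{y ∈ Y} f(y)`.  Typed with the hypothesis the printed
proof uses — every `x ∈ X` has an edge («no isolated vertices» on the `X` side; isolated `y` are
harmless).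
[cite: Jukna2001, Ch. 2 §2.2, Lemma 2.6; held p0038 l. 5–9] -/
theorem lemma_2_6 {X Y : Type*} [Fintype X] [Fintype Y] [DecidableEq X] [DecidableEq Y]
    (E : Finset (X × Y)) (f : Y → ℝ) (hf : ∀ y, 0 ≤ f y) (hX : ∀ x, ∃ y, (x, y) ∈ E)
    (h : ∀ x y, (x, y) ∈ E →
      ((univ.filter (fun x' => (x', y) ∈ E)).card : ℝ)
        ≤ (univ.filter (fun y' => (x, y') ∈ E)).card * f y) :
    (Fintype.card X : ℝ) ≤ ∑ y, f y := by
  set dX : X → ℕ := fun x => (univ.filter (fun y => (x, y) ∈ E)).card with hdXdef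
  set dY : Y → ℕ := fun y => (univ.filter (fun x => (x, y) ∈ E)).card with hdYdef
  have hdX : ∀ x, 0 < dX x := by
    intro x
    obtain ⟨y, hy⟩ := hX x
    exact card_pos.mpr ⟨y, by simp [hy]⟩
  have step1 : ∀ x, (∑ y, if (x, y) ∈ E then (1 : ℝ) / dX x else 0) = 1 := by
    intro x
    rw [← Finset.sum_filter, sum_const, nsmul_eq_mul, mul_one_div]
    exact div_self (by exact_mod_cast (hdX x).ne')
  have step2 : ∀ x y, (if (x, y) ∈ E then (1 : ℝ) / dX x else 0)
      ≤ (if (x, y) ∈ E then f y / dY y else 0) := by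
    intro x y
    split_ifs with hxy
    · have hx := hdX x
      have hy : 0 < dY y := card_pos.mpr ⟨x, by simp [hxy]⟩
      rw [div_le_div_iff₀ (by exact_mod_cast hx) (by exact_mod_cast hy), one_mul, mul_comm]
      exact h x y hxy
    · exact le_rfl
  have step3 : ∀ y, (∑ x, if (x, y) ∈ E then f y / dY y else 0) ≤ f y := by
    intro y
    rw [← Finset.sum_filter, sum_const, nsmul_eq_mul]
    by_cases h0 : dY y = 0
    · have : ((univ.filter (fun x => (x, y) ∈ E)).card : ℝ) = 0 := by exact_mod_cast h0
      rw [this, zero_mul]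
      exact hf y
    · have hne : (dY y : ℝ) ≠ 0 := by exact_mod_cast h0
      rw [← mul_div_assoc, mul_div_cancel_left₀ _ hne]
  calc (Fintype.card X : ℝ) = ∑ _x : X, (1 : ℝ) := by simp
    _ = ∑ x, ∑ y, if (x, y) ∈ E then (1 : ℝ) / dX x else 0 :=
        sum_congr rfl (fun x _ => (step1 x).symm)
    _ ≤ ∑ x, ∑ y, if (x, y) ∈ E then f y / dY y else 0 :=
        sum_le_sum (fun x _ => sum_le_sum (fun y _ => step2 x y))
    _ = ∑ y, ∑ x, if (x, y) ∈ E then f y / dY y else 0 := sum_comm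
    _ ≤ ∑ y, f y := sum_le_sum (fun y _ => step3 y)

/-- **Theorem 2.5** (Ossowski 1993; the proof of F. Galvin 1997): a bipartite graph
`G = (V₁, V₂, E)` with `|E| < (k+1) r` edges and `d(y) ≤ r` for all `y ∈ V₂`; then at most `k`
vertices can be deleted from `V₁` so that no `(r − a + 1) × a` clique remains, `a = 1, …, r` —
typed as: there is `X ⊆ V₁`, `|X| ≤ k`, with `|Γ(Y) ∖ X| ≤ r − |Y|` for every `Y ⊆ V₂` with
`1 ≤ |Y| ≤ r` («Put otherwise …»).  The printed «no isolated vertices» is not used and is dropped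
(a stronger statement).
[cite: Jukna2001, Ch. 2 §2.2, Theorem 2.5 with its proof;
held p0038 l. 1–3, p0038 l. 11 – p0039 l. 3] -/
theorem theorem_2_5 {V₁ V₂ : Type*} [Fintype V₁] [Fintype V₂] [DecidableEq V₁] [DecidableEq V₂]
    (E : Finset (V₁ × V₂)) {k r : ℕ} (hE : E.card < (k + 1) * r)
    (hdeg : ∀ y, (univ.filter (fun x => (x, y) ∈ E)).card ≤ r) :
    ∃ X : Finset V₁, X.card ≤ k ∧
      ∀ a, 1 ≤ a → a ≤ r → ∀ (A : Finset V₁) (B : Finset V₂),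
        A.card = r - a + 1 → B.card = a → Disjoint A X → ¬ A ×ˢ B ⊆ E := by
  classical
  have hr : 0 < r := by
    rcases Nat.eq_zero_or_pos r with h0 | h0
    · simp [h0] at hE
    · exact h0
  have hrpos : (0 : ℝ) < r := by exact_mod_cast hr
  set Γ : Finset V₂ → Finset V₁ := fun Y => univ.filter (fun x => ∀ y ∈ Y, (x, y) ∈ E) with hΓdef
  have memΓ : ∀ Y x, x ∈ Γ Y ↔ ∀ y ∈ Y, (x, y) ∈ E := fun Y x => by simp [hΓdef]
  set P : Finset V₁ → Prop := fun X => ∀ Y : Finset V₂, 1 ≤ Y.card → Y.card ≤ r →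
    ((Γ Y) \ X).card ≤ r - Y.card with hPdef
  have hPuniv : P univ := by
    intro Y _ _
    rw [Finset.sdiff_eq_empty_iff_subset.mpr (subset_univ _), card_empty]
    exact Nat.zero_le _
  obtain ⟨X, hXmem, hXmin⟩ := exists_min_image (univ.filter (fun X => P X)) Finset.card
    ⟨univ, by simpa using hPuniv⟩
  have hXP : P X := (mem_filter.1 hXmem).2
  refine ⟨X, ?_, ?_⟩
  swap
  · intro a ha1 har A B hA hB hdisj hsub
    have hAsub : A ⊆ Γ B \ X := by
      intro x hx
      rw [mem_sdiff, memΓ]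
      exact ⟨fun y hy => hsub (mk_mem_product hx hy), fun hxX => disjoint_left.1 hdisj hx hxX⟩
    have h1 := card_le_card hAsub
    have h2 := hXP B (by omega) (by omega)
    rw [hB] at h2
    omega
  -- minimality consequences
  have hYx : ∀ x ∈ X, ∃ Y : Finset V₂, 1 ≤ Y.card ∧ Y.card ≤ r ∧ x ∈ Γ Y ∧
      ((Γ Y) \ X).card = r - Y.card := by
    intro x hx
    have hnotP : ¬ P (X.erase x) := by
      intro hP'
      have h1 := hXmin (X.erase x) (by simp [hP'])
      rw [card_erase_of_mem hx] at h1
      have h2 := card_pos.mpr ⟨x, hx⟩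
      omega
    simp only [hPdef, not_forall, not_le, exists_prop] at hnotP
    obtain ⟨Y, hY1, hYr, hlt⟩ := hnotP
    have hsub : Γ Y \ X.erase x ⊆ insert x (Γ Y \ X) := by
      intro z hz
      rw [mem_sdiff, mem_erase] at hz
      rw [mem_insert, mem_sdiff]
      by_cases hzx : z = x
      · left; exact hzx
      · right; exact ⟨hz.1, fun hzX => hz.2 ⟨hzx, hzX⟩⟩
    have hle1 : (Γ Y \ X.erase x).card ≤ (Γ Y \ X).card + 1 :=
      (card_le_card hsub).trans (card_insert_le _ _)
    have hPX := hXP Y hY1 hYr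
    have heq : (Γ Y \ X).card = r - Y.card := by omega
    have hxΓ : x ∈ Γ Y := by
      by_contra hxΓ
      have hset : Γ Y \ X.erase x = Γ Y \ X := by
        ext z
        simp only [mem_sdiff, mem_erase, not_and]
        constructor
        · rintro ⟨hz, hz'⟩
          refine ⟨hz, fun hzX => ?_⟩
          have hzx : z ≠ x := fun hzx => hxΓ (hzx ▸ hz)
          exact hz' hzx hzX
        · rintro ⟨hz, hz'⟩
          exact ⟨hz, fun _ h => hz' h⟩
      rw [hset] at hlt
      omega
    exact ⟨Y, hY1, hYr, hxΓ, heq⟩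
  choose! Yx hYx1 hYxr hYxΓ hYxcard using hYx
  -- the auxiliary bipartite graph on X × V₂
  set F : Finset (X × V₂) := univ.filter (fun e => e.2 ∈ Yx (e.1 : V₁)) with hFdef
  set dY : V₂ → ℕ := fun y => (univ.filter (fun x => (x, y) ∈ E)).card with hdYdef
  have memF : ∀ (x : X) (y : V₂), (x, y) ∈ F ↔ y ∈ Yx (x : V₁) := fun x y => by simp [hFdef]
  have hFX : ∀ x : X, ∃ y, (x, y) ∈ F := by
    intro x
    have h1 := hYx1 (x : V₁) x.2
    obtain ⟨y, hy⟩ := card_pos.mp (by omega : 0 < (Yx (x : V₁)).card)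
    exact ⟨y, (memF x y).2 hy⟩
  have hFineq : ∀ (x : X) (y : V₂), (x, y) ∈ F →
      ((univ.filter (fun x' : X => (x', y) ∈ F)).card : ℝ)
        ≤ (univ.filter (fun y' => (x, y') ∈ F)).card * ((dY y : ℝ) / r) := by
    intro x y hxy
    have hy : y ∈ Yx (x : V₁) := (memF x y).1 hxy
    have hdFx : (univ.filter (fun y' => (x, y') ∈ F)) = Yx (x : V₁) := by
      ext y'
      simp [hFdef]
    have hdFy : (univ.filter (fun x' : X => (x', y) ∈ F)).card
        ≤ (X.filter (fun x' => (x', y) ∈ E)).card := by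
      have hsub : (univ.filter (fun x' : X => (x', y) ∈ F)).map (Function.Embedding.subtype _)
          ⊆ X.filter (fun x' => (x', y) ∈ E) := by
        intro z hz
        rw [mem_map] at hz
        obtain ⟨x', hx', rfl⟩ := hz
        have hx'' : y ∈ Yx (x' : V₁) := (memF x' y).1 (mem_filter.1 hx').2
        rw [mem_filter]
        refine ⟨x'.2, ?_⟩
        exact (memΓ _ _).1 (hYxΓ (x' : V₁) x'.2) y hx''
      calc _ = ((univ.filter (fun x' : X => (x', y) ∈ F)).map
            (Function.Embedding.subtype _)).card := (card_map _).symm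
        _ ≤ _ := card_le_card hsub
    have hdisj : Disjoint (X.filter (fun x' => (x', y) ∈ E)) ((Γ (Yx (x : V₁))) \ X) :=
      disjoint_left.2 (fun z hz1 hz2 => (mem_sdiff.1 hz2).2 (mem_filter.1 hz1).1)
    have hsplit : (X.filter (fun x' => (x', y) ∈ E)).card + ((Γ (Yx (x : V₁))) \ X).card
        ≤ dY y := by
      rw [← card_union_of_disjoint hdisj]
      apply card_le_card
      intro z hz
      rw [mem_union] at hz
      simp only [mem_filter, mem_univ, true_and]
      rcases hz with hz | hz
      · exact (mem_filter.1 hz).2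
      · exact (memΓ _ _).1 (mem_sdiff.1 hz).1 y hy
    rw [hYxcard (x : V₁) x.2] at hsplit
    have hYr' := hYxr (x : V₁) x.2
    have hdy := hdeg y
    rw [hdFx]
    have e1 : ((univ.filter (fun x' : X => (x', y) ∈ F)).card : ℝ)
        ≤ (dY y : ℝ) - (r - (Yx (x : V₁)).card) := by
      have h1 : ((X.filter (fun x' => (x', y) ∈ E)).card : ℝ)
          + ((r - (Yx (x : V₁)).card : ℕ) : ℝ) ≤ dY y := by exact_mod_cast hsplit
      rw [Nat.cast_sub hYr'] at h1
      have h2 : ((univ.filter (fun x' : X => (x', y) ∈ F)).card : ℝ)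
          ≤ (X.filter (fun x' => (x', y) ∈ E)).card := by exact_mod_cast hdFy
      linarith
    have f1 : ((Yx (x : V₁)).card : ℝ) ≤ r := by exact_mod_cast hYr'
    have f2 : (dY y : ℝ) ≤ r := by exact_mod_cast hdy
    rw [mul_div_assoc', le_div_iff₀ hrpos]
    nlinarith [mul_le_mul_of_nonneg_right e1 hrpos.le,
      mul_nonneg (sub_nonneg.2 f1) (sub_nonneg.2 f2)]
  have h26 := lemma_2_6 F (fun y => (dY y : ℝ) / r) (fun y => by positivity) hFX hFineq
  have hsum : ∑ y, ((dY y : ℝ) / r) = (E.card : ℝ) / r := by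
    rw [← Finset.sum_div]
    congr 1
    exact_mod_cast sum_card_col_eq_card E
  rw [hsum, Fintype.card_coe] at h26
  have hE' : (E.card : ℝ) < (k + 1) * r := by exact_mod_cast hE
  have hlt : (X.card : ℝ) < k + 1 := by
    calc (X.card : ℝ) ≤ E.card / r := h26
      _ < k + 1 := by rw [div_lt_iff₀ hrpos]; exact hE'
  have : X.card < k + 1 := by exact_mod_cast hlt
  omega

end Zarankiewicz


section Density

/-- **Lemma 2.7** (Grigni–Sipser 1995): an `m × n` 0-1 matrix `H` (the finset of its 1-entries) that
is `2a`-dense (`2a·mn ≤ |H|`) has (a) a `√a`-dense row (`√a·n ≤` its number of 1's), or (b) at least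
`√a·m` rows that are `a`-dense.
[cite: Jukna2001, Ch. 2 §2.3, Lemma 2.7; held p0039 l. 7–18] -/
theorem lemma_2_7 {ι κ : Type*} [Fintype ι] [Fintype κ] [DecidableEq ι] [DecidableEq κ]
    (H : Finset (ι × κ)) {a : ℝ}
    (hH : 2 * a * (Fintype.card ι * Fintype.card κ) ≤ H.card) :
    (∃ i, Real.sqrt a * Fintype.card κ ≤ (univ.filter (fun j => (i, j) ∈ H)).card) ∨
    Real.sqrt a * Fintype.card ι ≤
      (univ.filter (fun i =>
        a * Fintype.card κ ≤ (univ.filter (fun j => (i, j) ∈ H)).card)).card := by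
  by_contra hcon
  push Not at hcon
  obtain ⟨h1, h2⟩ := hcon
  set m := Fintype.card ι with hmdef
  set n := Fintype.card κ with hndef
  set r : ι → ℕ := fun i => (univ.filter (fun j => (i, j) ∈ H)).card with hrdef
  set D := univ.filter (fun i => a * n ≤ (r i : ℝ)) with hDdef
  -- positivity consequences of the negated conclusion
  have hsm : 0 < Real.sqrt a * m := lt_of_le_of_lt (Nat.cast_nonneg _) h2
  have hsa : 0 < Real.sqrt a := by
    rcases (Real.sqrt_nonneg a).eq_or_lt with h0 | h0
    · rw [← h0, zero_mul] at hsm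
      exact absurd hsm (lt_irrefl 0)
    · exact h0
  have ha : 0 < a := Real.sqrt_pos.mp hsa
  have hm : 0 < m := by
    rcases Nat.eq_zero_or_pos m with hm0 | hm0
    · rw [hm0, Nat.cast_zero, mul_zero] at hsm
      exact absurd hsm (lt_irrefl 0)
    · exact hm0
  obtain ⟨i₀⟩ : Nonempty ι := Fintype.card_pos_iff.mp hm
  have hsn : 0 < Real.sqrt a * n := lt_of_le_of_lt (Nat.cast_nonneg _) (h1 i₀)
  have hsq : Real.sqrt a * Real.sqrt a = a := Real.mul_self_sqrt ha.le
  -- the count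
  have hrows : (H.card : ℝ) = ∑ i, (r i : ℝ) := by
    exact_mod_cast Literature.Combinatorics.Extremal.ZarankiewiczQuadrilateral.card_eq_sum_degree H
  have hsplit : ∑ i, (r i : ℝ)
      = ∑ i ∈ D, (r i : ℝ) + ∑ i ∈ univ.filter (fun i => ¬ (a * n ≤ (r i : ℝ))), (r i : ℝ) :=
    (sum_filter_add_sum_filter_not univ _ _).symm
  have hD : ∑ i ∈ D, (r i : ℝ) ≤ D.card * (Real.sqrt a * n) := by
    have := sum_le_card_nsmul D (fun i => (r i : ℝ)) _ (fun i _ => (h1 i).le)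
    rwa [nsmul_eq_mul] at this
  have hDc : ∑ i ∈ univ.filter (fun i => ¬ (a * n ≤ (r i : ℝ))), (r i : ℝ)
      ≤ (univ.filter (fun i => ¬ (a * n ≤ (r i : ℝ)))).card * (a * n) := by
    have := sum_le_card_nsmul (univ.filter (fun i => ¬ (a * n ≤ (r i : ℝ)))) (fun i => (r i : ℝ))
      (a * n) (fun i hi => (not_le.1 (mem_filter.1 hi).2).le)
    rwa [nsmul_eq_mul] at this
  have hDc' : ((univ.filter (fun i => ¬ (a * n ≤ (r i : ℝ)))).card : ℝ) * (a * n)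
      ≤ m * (a * n) := by
    apply mul_le_mul_of_nonneg_right _ (by positivity)
    exact_mod_cast (card_filter_le _ _).trans (card_univ (α := ι)).le
  have hD' : (D.card : ℝ) * (Real.sqrt a * n) < Real.sqrt a * m * (Real.sqrt a * n) :=
    mul_lt_mul_of_pos_right h2 hsn
  have hprod : Real.sqrt a * m * (Real.sqrt a * n) = a * (m * n) := by
    calc Real.sqrt a * m * (Real.sqrt a * n) = (Real.sqrt a * Real.sqrt a) * (m * n) := by ring
      _ = a * (m * n) := by rw [hsq]
  linarith

/-- **Lemma 2.8** (J. Håstad; Karchmer–Wigderson 1990), cleared of the divisions: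
`H ⊆ A_1 × ⋯ × A_k`, `B_i := {b ∈ A_i : μ(H_{i→b}) ≥ μ(H)/(2k)}` — i.e.
`|H| ≤ 2k·|A_i|·#{a ∈ H : a_i = b}` — and `B := B_1 × ⋯ × B_k`; then `μ(B) ≥ μ(H)/2`, i.e.
`|H| ≤ 2|B|`.
[cite: Jukna2001, Ch. 2 §2.3, Lemma 2.8 with the definitions before it;
held p0039 l. 22 – p0040 l. 6] -/
theorem lemma_2_8 {ι : Type*} [Fintype ι] [DecidableEq ι] {A : ι → Type*}
    [∀ i, Fintype (A i)] [∀ i, DecidableEq (A i)] (H : Finset (∀ i, A i)) :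
    H.card ≤ 2 * ((Finset.univ : Finset (∀ i, A i)).filter (fun a => ∀ i,
      H.card ≤ 2 * Fintype.card ι * Fintype.card (A i)
        * (H.filter (fun x => x i = a i)).card)).card := by
  classical
  set k := Fintype.card ι with hkdef
  set c : (i : ι) → A i → ℕ := fun i b => (H.filter (fun x => x i = b)).card with hcdef
  set dense : (i : ι) → A i → Prop := fun i b => H.card ≤ 2 * k * Fintype.card (A i) * c i b
    with hdensedef
  set B := (Finset.univ : Finset (∀ i, A i)).filter (fun a => ∀ i, dense i (a i)) with hBdef
  set Bad : ι → Finset (∀ i, A i) := fun i => H.filter (fun a => ¬ dense i (a i)) with hBaddef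
  -- Claim 1: each thin part is small
  have hBad : ∀ i, 2 * k * (Bad i).card ≤ H.card := by
    intro i
    rcases Nat.eq_zero_or_pos (Fintype.card (A i)) with h0 | hpos
    · haveI : IsEmpty (A i) := Fintype.card_eq_zero_iff.mp h0
      have : Bad i = ∅ := by
        rw [Finset.eq_empty_iff_forall_notMem]
        intro a _
        exact isEmptyElim (a i)
      rw [this, card_empty, mul_zero]
      exact Nat.zero_le _
    · set S := (univ : Finset (A i)).filter (fun b => ¬ dense i b) with hSdef
      have hfib : (Bad i).card = ∑ b ∈ S, c i b := by
        rw [card_eq_sum_card_fiberwise (f := fun a : (∀ i, A i) => a i) (s := Bad i) (t := S)]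
        · refine sum_congr rfl (fun b hb => ?_)
          have hb' : ¬ dense i b := (mem_filter.1 hb).2
          simp only [hcdef]
          congr 1
          ext a
          simp only [hBaddef, mem_filter]
          constructor
          · rintro ⟨⟨ha, _⟩, hab⟩; exact ⟨ha, hab⟩
          · rintro ⟨ha, hab⟩; exact ⟨⟨ha, hab ▸ hb'⟩, hab⟩
        · intro a ha
          have ha' := (mem_filter.1 (Finset.mem_coe.1 ha)).2
          simp only [coe_filter, mem_univ, true_and, Set.mem_setOf_eq, hSdef]
          exact ha'
      have hsum : ∑ b ∈ S, 2 * k * Fintype.card (A i) * c i b ≤ S.card * H.card := by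
        have := sum_le_card_nsmul S (fun b => 2 * k * Fintype.card (A i) * c i b) H.card
          (fun b hb => (not_le.1 (mem_filter.1 hb).2).le)
        rwa [smul_eq_mul] at this
      have hS : S.card ≤ Fintype.card (A i) := (card_filter_le _ _).trans (card_univ (α := A i)).le
      have key : Fintype.card (A i) * (2 * k * (Bad i).card)
          ≤ Fintype.card (A i) * H.card := by
        calc Fintype.card (A i) * (2 * k * (Bad i).card)
            = ∑ b ∈ S, 2 * k * Fintype.card (A i) * c i b := by
              rw [hfib, mul_sum, mul_sum]
              refine sum_congr rfl (fun b _ => by ring)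
          _ ≤ S.card * H.card := hsum
          _ ≤ Fintype.card (A i) * H.card := Nat.mul_le_mul_right _ hS
      exact Nat.le_of_mul_le_mul_left key hpos
  -- Claim 2: H splits into its dense part (inside B) and the thin parts
  have hsplit : H.card = (H.filter (fun a => ∀ i, dense i (a i))).card
      + (H.filter (fun a => ¬ ∀ i, dense i (a i))).card :=
    (card_filter_add_card_filter_not _).symm
  have hin : (H.filter (fun a => ∀ i, dense i (a i))).card ≤ B.card :=
    card_le_card (fun a ha => by
      rw [hBdef, mem_filter]
      exact ⟨mem_univ _, (mem_filter.1 ha).2⟩)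
  have hout : (H.filter (fun a => ¬ ∀ i, dense i (a i))).card ≤ ∑ i, (Bad i).card := by
    have hsub : H.filter (fun a => ¬ ∀ i, dense i (a i)) ⊆ univ.biUnion Bad := by
      intro a ha
      obtain ⟨haH, hna⟩ := mem_filter.1 ha
      rw [not_forall] at hna
      obtain ⟨i, hi⟩ := hna
      rw [mem_biUnion]
      exact ⟨i, mem_univ _, mem_filter.2 ⟨haH, hi⟩⟩
    exact (card_le_card hsub).trans card_biUnion_le
  rcases Nat.eq_zero_or_pos k with hk0 | hkpos
  · haveI : IsEmpty ι := Fintype.card_eq_zero_iff.mp (hkdef ▸ hk0)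
    have hB : B = univ := by
      ext a
      simp [hBdef]
    rw [hB, card_univ]
    calc H.card ≤ Fintype.card (∀ i, A i) := card_le_univ H
      _ ≤ 2 * Fintype.card (∀ i, A i) := by omega
  · have hsumBad : 2 * k * ∑ i, (Bad i).card ≤ k * H.card := by
      rw [mul_sum]
      calc ∑ i, 2 * k * (Bad i).card ≤ ∑ _i : ι, H.card := sum_le_sum (fun i _ => hBad i)
        _ = k * H.card := by rw [sum_const, card_univ, smul_eq_mul]
    have key : k * (2 * H.card) ≤ k * (2 * (2 * B.card)) := by
      have e1 : 2 * k * H.card = 2 * k * (H.filter (fun a => ∀ i, dense i (a i))).card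
          + 2 * k * (H.filter (fun a => ¬ ∀ i, dense i (a i))).card := by
        rw [← mul_add, ← hsplit]
      have e2 : 2 * k * (H.filter (fun a => ¬ ∀ i, dense i (a i))).card ≤ k * H.card :=
        (Nat.mul_le_mul_left _ hout).trans hsumBad
      have e3 : 2 * k * (H.filter (fun a => ∀ i, dense i (a i))).card ≤ 2 * k * B.card :=
        Nat.mul_le_mul_left _ hin
      nlinarith
    have := Nat.le_of_mul_le_mul_left key hkpos
    omega

/-- **Corollary 2.9**: in a `2a`-dense `m × n` 0-1 matrix either at least `√a·m` rows are
`(a/2)`-dense or at least `√a·n` columns are `(a/2)`-dense (or both).  Proved here by the direct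
double count (the book derives it from Lemma 2.8 with `k = 2`).
[cite: Jukna2001, Ch. 2 §2.3, Corollary 2.9; held p0040 l. 8–10] -/
theorem corollary_2_9 {ι κ : Type*} [Fintype ι] [Fintype κ] [DecidableEq ι] [DecidableEq κ]
    (H : Finset (ι × κ)) {a : ℝ}
    (hH : 2 * a * (Fintype.card ι * Fintype.card κ) ≤ H.card) :
    Real.sqrt a * Fintype.card ι ≤
      (univ.filter (fun i =>
        a / 2 * Fintype.card κ ≤ (univ.filter (fun j => (i, j) ∈ H)).card)).card ∨
    Real.sqrt a * Fintype.card κ ≤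
      (univ.filter (fun j =>
        a / 2 * Fintype.card ι ≤ (univ.filter (fun i => (i, j) ∈ H)).card)).card := by
  by_contra hcon
  push Not at hcon
  obtain ⟨h1, h2⟩ := hcon
  set m := Fintype.card ι with hmdef
  set n := Fintype.card κ with hndef
  set r : ι → ℕ := fun i => (univ.filter (fun j => (i, j) ∈ H)).card with hrdef
  set c : κ → ℕ := fun j => (univ.filter (fun i => (i, j) ∈ H)).card with hcdef
  set R := univ.filter (fun i => a / 2 * n ≤ (r i : ℝ)) with hRdef
  set C := univ.filter (fun j => a / 2 * m ≤ (c j : ℝ)) with hCdef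
  -- positivity
  have hsm : 0 < Real.sqrt a * m := lt_of_le_of_lt (Nat.cast_nonneg _) h1
  have hsn : 0 < Real.sqrt a * n := lt_of_le_of_lt (Nat.cast_nonneg _) h2
  have hsa : 0 < Real.sqrt a := by
    rcases (Real.sqrt_nonneg a).eq_or_lt with h0 | h0
    · rw [← h0, zero_mul] at hsm
      exact absurd hsm (lt_irrefl 0)
    · exact h0
  have ha : 0 < a := Real.sqrt_pos.mp hsa
  have hsq : Real.sqrt a * Real.sqrt a = a := Real.mul_self_sqrt ha.le
  -- rows split
  have hrows : (H.card : ℝ) = ∑ i, (r i : ℝ) := by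
    exact_mod_cast Literature.Combinatorics.Extremal.ZarankiewiczQuadrilateral.card_eq_sum_degree H
  have hsplit : ∑ i, (r i : ℝ)
      = ∑ i ∈ R, (r i : ℝ) + ∑ i ∈ univ.filter (fun i => ¬ (a / 2 * n ≤ (r i : ℝ))), (r i : ℝ) :=
    (sum_filter_add_sum_filter_not univ _ _).symm
  -- light rows
  have hlight : ∑ i ∈ univ.filter (fun i => ¬ (a / 2 * n ≤ (r i : ℝ))), (r i : ℝ)
      ≤ m * (a / 2 * n) := by
    have := sum_le_card_nsmul (univ.filter (fun i => ¬ (a / 2 * n ≤ (r i : ℝ))))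
      (fun i => (r i : ℝ)) (a / 2 * n) (fun i hi => (not_le.1 (mem_filter.1 hi).2).le)
    rw [nsmul_eq_mul] at this
    refine this.trans (mul_le_mul_of_nonneg_right ?_ (by positivity))
    exact_mod_cast (card_filter_le _ _).trans (card_univ (α := ι)).le
  -- heavy rows: r i ≤ |C| + (entries in light columns)
  set t : ι → ℕ := fun i => ((univ.filter (fun j => ¬ (a / 2 * m ≤ (c j : ℝ)))).filter
    (fun j => (i, j) ∈ H)).card with htdef
  have hri : ∀ i, (r i : ℝ) ≤ C.card + t i := by
    intro i
    have hsub : univ.filter (fun j => (i, j) ∈ H)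
        ⊆ C ∪ ((univ.filter (fun j => ¬ (a / 2 * m ≤ (c j : ℝ)))).filter
          (fun j => (i, j) ∈ H)) := by
      intro j hj
      have hj' := (mem_filter.1 hj).2
      rw [mem_union]
      by_cases hjC : a / 2 * m ≤ (c j : ℝ)
      · left; exact mem_filter.2 ⟨mem_univ _, hjC⟩
      · right; exact mem_filter.2 ⟨mem_filter.2 ⟨mem_univ _, hjC⟩, hj'⟩
    exact_mod_cast (card_le_card hsub).trans (card_union_le _ _)
  have hswap : ∑ i, t i = ∑ j ∈ univ.filter (fun j => ¬ (a / 2 * m ≤ (c j : ℝ))), c j := by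
    have h := Finset.sum_card_bipartiteAbove_eq_sum_card_bipartiteBelow
      (s := (univ : Finset ι)) (t := univ.filter (fun j => ¬ (a / 2 * m ≤ (c j : ℝ))))
      (fun i j => (i, j) ∈ H)
    simp only [Finset.bipartiteAbove, Finset.bipartiteBelow] at h
    exact h
  have hlightcol : (∑ j ∈ univ.filter (fun j => ¬ (a / 2 * m ≤ (c j : ℝ))), (c j : ℝ))
      ≤ n * (a / 2 * m) := by
    have := sum_le_card_nsmul (univ.filter (fun j => ¬ (a / 2 * m ≤ (c j : ℝ))))
      (fun j => (c j : ℝ)) (a / 2 * m) (fun j hj => (not_le.1 (mem_filter.1 hj).2).le)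
    rw [nsmul_eq_mul] at this
    refine this.trans (mul_le_mul_of_nonneg_right ?_ (by positivity))
    exact_mod_cast (card_filter_le _ _).trans (card_univ (α := κ)).le
  have hheavy : ∑ i ∈ R, (r i : ℝ) ≤ R.card * C.card + n * (a / 2 * m) := by
    calc ∑ i ∈ R, (r i : ℝ) ≤ ∑ i ∈ R, ((C.card : ℝ) + t i) := sum_le_sum (fun i _ => hri i)
      _ = R.card * C.card + ∑ i ∈ R, (t i : ℝ) := by
          rw [sum_add_distrib, sum_const, nsmul_eq_mul]
      _ ≤ R.card * C.card + ∑ i, (t i : ℝ) := by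
          have : ∑ i ∈ R, (t i : ℝ) ≤ ∑ i, (t i : ℝ) :=
            sum_le_univ_sum_of_nonneg (fun i => by positivity)
          linarith
      _ = R.card * C.card + ∑ j ∈ univ.filter (fun j => ¬ (a / 2 * m ≤ (c j : ℝ))), (c j : ℝ) := by
          congr 1
          exact_mod_cast hswap
      _ ≤ R.card * C.card + n * (a / 2 * m) := by linarith [hlightcol]
  -- the product |R| |C| is too small
  have hRC : (R.card : ℝ) * C.card < a * (m * n) := by
    have hR0 : (0 : ℝ) ≤ R.card := Nat.cast_nonneg _
    have e1 : (R.card : ℝ) * C.card ≤ R.card * (Real.sqrt a * n) :=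
      mul_le_mul_of_nonneg_left h2.le hR0
    have e2 : (R.card : ℝ) * (Real.sqrt a * n) < Real.sqrt a * m * (Real.sqrt a * n) :=
      mul_lt_mul_of_pos_right h1 hsn
    have e3 : Real.sqrt a * m * (Real.sqrt a * n) = a * (m * n) := by
      calc Real.sqrt a * m * (Real.sqrt a * n) = (Real.sqrt a * Real.sqrt a) * (m * n) := by ring
        _ = a * (m * n) := by rw [hsq]
    linarith
  linarith

end Density

section Exercises

/-- Exercise 2.1 for the members indexed by a finset `s`, with the union as ground set:
`Σ_{i ∈ s} |A_i| ≤ |⋃_{i ∈ s} A_i| + t·C(|s|, 2)` (the induction behind Exercise 2.1).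
[cite: Jukna2001, Ch. 2 Exercise 2.1; held p0040 l. 14] -/
theorem exercise_2_1_aux {α ι : Type*} [DecidableEq α] [DecidableEq ι]
    (A : ι → Finset α) {t : ℕ} (ht : ∀ i j, i ≠ j → (A i ∩ A j).card ≤ t) (s : Finset ι) :
    ∑ i ∈ s, (A i).card ≤ (s.biUnion A).card + t * s.card.choose 2 := by
  induction s using Finset.induction_on with
  | empty => simp
  | @insert a s ha ih =>
    rw [sum_insert ha, biUnion_insert, card_insert_of_notMem ha]
    have h1 := card_union_add_card_inter (A a) (s.biUnion A)
    have h2 : (A a ∩ s.biUnion A).card ≤ s.card * t := by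
      rw [inter_biUnion]
      calc _ ≤ ∑ i ∈ s, (A a ∩ A i).card := card_biUnion_le
        _ ≤ s.card • t := sum_le_card_nsmul _ _ _ (fun i hi => ht a i (fun h => ha (h ▸ hi)))
        _ = s.card * t := smul_eq_mul _ _
    have hc : (s.card + 1).choose 2 = s.card + s.card.choose 2 := by
      rw [Nat.choose_succ_succ', Nat.choose_one_right]
    rw [hc, mul_add]
    nlinarith [h1, h2, ih]

/-- **Exercise 2.1**: subsets `A_1, …, A_m` of an `n`-element set with `|A_i ∩ A_j| ≤ t` for `i ≠ j`
satisfy `Σ_i |A_i| ≤ n + t·C(m, 2)`.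
[cite: Jukna2001, Ch. 2 Exercise 2.1; held p0040 l. 14] -/
theorem exercise_2_1 {α ι : Type*} [DecidableEq α] [Fintype ι] [DecidableEq ι]
    (A : ι → Finset α) (X : Finset α) (hX : ∀ i, A i ⊆ X) {t : ℕ}
    (ht : ∀ i j, i ≠ j → (A i ∩ A j).card ≤ t) :
    ∑ i, (A i).card ≤ X.card + t * (Fintype.card ι).choose 2 := by
  have h1 := exercise_2_1_aux A ht univ
  have h2 : (univ.biUnion A).card ≤ X.card :=
    card_le_card (biUnion_subset.2 (fun i _ => hX i))
  rw [card_univ] at h1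
  omega

/-- The hint of **Exercise 2.3**: `p(x) = d(x)² + (m − d(x))²`, where `p(x)` counts the ORDERED
pairs `(A, B) ∈ 𝓕 × 𝓕` (here with `A = B` allowed, as the identity requires) with `x ∈ A ∩ B` or
`x ∉ A ∪ B`.
[cite: Jukna2001, Ch. 2 Exercise 2.3 (hint); held p0040 l. 19–21] -/
theorem exercise_2_3_count {α : Type*} [DecidableEq α] (𝓕 : Finset (Finset α)) (x : α) :
    ((𝓕 ×ˢ 𝓕).filter (fun p => (x ∈ p.1 ∧ x ∈ p.2) ∨ (x ∉ p.1 ∧ x ∉ p.2))).card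
      = (𝓕.filter (fun A => x ∈ A)).card ^ 2
        + (𝓕.card - (𝓕.filter (fun A => x ∈ A)).card) ^ 2 := by
  set D := 𝓕.filter (fun A => x ∈ A) with hDdef
  set Dc := 𝓕.filter (fun A => ¬ x ∈ A) with hDcdef
  have hset : (𝓕 ×ˢ 𝓕).filter (fun p => (x ∈ p.1 ∧ x ∈ p.2) ∨ (x ∉ p.1 ∧ x ∉ p.2))
      = D ×ˢ D ∪ Dc ×ˢ Dc := by
    ext ⟨A, B⟩
    simp only [mem_filter, mem_product, mem_union, hDdef, hDcdef]
    tauto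
  have hdisj : Disjoint (D ×ˢ D) (Dc ×ˢ Dc) := by
    rw [disjoint_left]
    rintro ⟨A, B⟩ h1 h2
    rw [mem_product] at h1 h2
    exact (mem_filter.1 h2.1).2 (mem_filter.1 h1.1).2
  have hcard : Dc.card = 𝓕.card - D.card := by
    have := card_filter_add_card_filter_not (s := 𝓕) (fun A => x ∈ A)
    rw [← hDdef, ← hDcdef] at this
    omega
  rw [hset, card_union_of_disjoint hdisj, card_product, card_product, hcard, sq, sq]

/-- **Exercise 2.3**: `p(x) ≥ m²/2`, typed as `m² ≤ 2·p(x)` with `p(x)` counting ordered pairs,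
`A = B` allowed (the form its hint proves; with the printed «A ≠ B» the claim fails already for
`m = 2`, `𝓕 = {A, B}`, `x ∈ A ∖ B`, where no pair qualifies).
[cite: Jukna2001, Ch. 2 Exercise 2.3; held p0040 l. 19–21] -/
theorem exercise_2_3 {α : Type*} [DecidableEq α] (𝓕 : Finset (Finset α)) (x : α) :
    𝓕.card ^ 2
      ≤ 2 * ((𝓕 ×ˢ 𝓕).filter (fun p => (x ∈ p.1 ∧ x ∈ p.2) ∨ (x ∉ p.1 ∧ x ∉ p.2))).card := by
  rw [exercise_2_3_count]
  set d := (𝓕.filter (fun A => x ∈ A)).card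
  have hd : d ≤ 𝓕.card := card_filter_le _ _
  obtain ⟨e, he⟩ : ∃ e, 𝓕.card = d + e := ⟨𝓕.card - d, by omega⟩
  rw [he, Nat.add_sub_cancel_left]
  nlinarith [sq_nonneg ((d : ℤ) - e)]

/-- **Exercise 2.5**, the hypotheses of Corrádi's lemma for a projective plane of order `q = r − 1`
(Mathlib's `Configuration.ProjectivePlane`): every line carries `q + 1 = r` points and two distinct
lines share at most one point (Mathlib: `Configuration.ProjectivePlane.pointCount_eq`,
`Configuration.Nondegenerate.eq_or_eq`; the tree's
`Literature.Combinatorics.Extremal.ZarankiewiczQuadrilateral.incidence_quadrilateral_free`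
is the `K(2,2)`-free form).
[cite: Jukna2001, Ch. 2 Exercise 2.5; held p0041 l. 2] -/
theorem exercise_2_5_lines (P L : Type*) [Membership P L] [Fintype P] [Fintype L] [DecidableEq P]
    [∀ (p : P) (l : L), Decidable (p ∈ l)] [Configuration.ProjectivePlane P L] :
    (∀ l : L, (univ.filter (fun p : P => p ∈ l)).card
      = Configuration.ProjectivePlane.order P L + 1) ∧
    (∀ l₁ l₂ : L, l₁ ≠ l₂ →
      (univ.filter (fun p : P => p ∈ l₁) ∩ univ.filter (fun p : P => p ∈ l₂)).card ≤ 1) := by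
  constructor
  · intro l
    have h := Configuration.ProjectivePlane.pointCount_eq P l
    rw [← h]
    unfold Configuration.pointCount
    rw [Nat.card_eq_fintype_card]
    convert (Fintype.card_subtype _).symm
  · intro l₁ l₂ hne
    rw [card_le_one]
    intro p₁ hp₁ p₂ hp₂
    rw [mem_inter, mem_filter, mem_filter] at hp₁ hp₂
    rcases Configuration.Nondegenerate.eq_or_eq hp₁.1.2 hp₂.1.2 hp₁.2.2 hp₂.2.2 with h | h
    · exact h
    · exact absurd h hne

/-- **Exercise 2.5**: the lines of a projective plane of order `q = r − 1` attain EQUALITY in (2.1):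
with `N = |L|` lines of size `r = q + 1`, pairwise intersections `k = 1` and `|X| = |P|` points,
`r² N = |X| · (r + (N − 1)·1)` (both sides equal `(q+1)²(q²+q+1)`; Mathlib's
`Configuration.ProjectivePlane.card_points` / `card_lines`).
[cite: Jukna2001, Ch. 2 Exercise 2.5; held p0041 l. 2] -/
theorem exercise_2_5 (P L : Type*) [Membership P L] [Fintype P] [Fintype L]
    [Configuration.ProjectivePlane P L] :
    (Configuration.ProjectivePlane.order P L + 1) ^ 2 * Fintype.card L
      = Fintype.card P
        * ((Configuration.ProjectivePlane.order P L + 1) + (Fintype.card L - 1) * 1) := by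
  rw [Configuration.ProjectivePlane.card_points P L, Configuration.ProjectivePlane.card_lines P L,
    Nat.add_sub_cancel]
  ring

/-- **Exercise 2.11** (the averaging principle for partitions), first part, typed for block sizes
`|A_1|, …, |A_m|` with average `a = Σ|A_i|/m` and any real `b > 0`: the blocks of size at least
`a/b` contain at least `(1 − 1/b)·|X|` elements, `|X| = Σ_i |A_i|` (disjointness plays no role in
the count, so it is not assumed).
[cite: Jukna2001, Ch. 2 Exercise 2.11; held p0042 l. 5] -/
theorem exercise_2_11 {α ι : Type*} [Fintype ι] (A : ι → Finset α) {b : ℝ} (hb : 0 < b) :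
    (1 - 1 / b) * (∑ i, ((A i).card : ℝ)) ≤
      ∑ i ∈ univ.filter (fun i =>
        (∑ j, ((A j).card : ℝ)) / Fintype.card ι / b ≤ (A i).card), ((A i).card : ℝ) := by
  set S := ∑ j, ((A j).card : ℝ) with hSdef
  set m := Fintype.card ι with hmdef
  rcases Nat.eq_zero_or_pos m with hm0 | hmpos
  · haveI : IsEmpty ι := Fintype.card_eq_zero_iff.mp (hmdef ▸ hm0)
    simp [hSdef]
  have hmr : (0 : ℝ) < m := by exact_mod_cast hmpos
  have hsplit : S = ∑ i ∈ univ.filter (fun i => S / m / b ≤ ((A i).card : ℝ)), ((A i).card : ℝ)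
      + ∑ i ∈ univ.filter (fun i => ¬ (S / m / b ≤ ((A i).card : ℝ))), ((A i).card : ℝ) :=
    (sum_filter_add_sum_filter_not univ _ _).symm
  have hsmall : ∑ i ∈ univ.filter (fun i => ¬ (S / m / b ≤ ((A i).card : ℝ))), ((A i).card : ℝ)
      ≤ S / b := by
    have := sum_le_card_nsmul (univ.filter (fun i => ¬ (S / m / b ≤ ((A i).card : ℝ))))
      (fun i => ((A i).card : ℝ)) (S / m / b) (fun i hi => (not_le.1 (mem_filter.1 hi).2).le)
    rw [nsmul_eq_mul] at this
    have hS0 : 0 ≤ S := by rw [hSdef]; exact sum_nonneg (fun j _ => Nat.cast_nonneg _)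
    have hcard : ((univ.filter (fun i => ¬ (S / m / b ≤ ((A i).card : ℝ)))).card : ℝ) ≤ m := by
      exact_mod_cast (card_filter_le _ _).trans (card_univ (α := ι)).le
    calc _ ≤ ((univ.filter (fun i => ¬ (S / m / b ≤ ((A i).card : ℝ)))).card : ℝ) * (S / m / b) :=
          this
      _ ≤ m * (S / m / b) :=
          mul_le_mul_of_nonneg_right hcard (div_nonneg (div_nonneg hS0 (Nat.cast_nonneg _)) hb.le)
      _ = S / b := by field_simp
  have : (1 - 1 / b) * S = S - S / b := by ring
  linarith

/-- **Exercise 2.11**, the question «How many elements of X belong to blocks of size at most ab?»,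
answered at the level of BLOCKS (Markov's inequality on the block sizes): at least `(1 − 1/b)·m` of
the blocks have size at most `a·b`.  (The number of ELEMENTS in such blocks has no positive lower
bound in general — two blocks of sizes `0` and `2a` with `1 < b < 2` — so no element-level bound is
typed; the question is printed without an answer.)
[cite: Jukna2001, Ch. 2 Exercise 2.11 (second question); held p0042 l. 5] -/
theorem exercise_2_11_blocks {α ι : Type*} [Fintype ι] (A : ι → Finset α) {b : ℝ} (hb : 0 < b) :
    (1 - 1 / b) * Fintype.card ι ≤
      ((univ.filter (fun i =>
        ((A i).card : ℝ) ≤ (∑ j, ((A j).card : ℝ)) / Fintype.card ι * b)).card : ℝ) := by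
  set S := ∑ j, ((A j).card : ℝ) with hSdef
  set m := Fintype.card ι with hmdef
  have hle1 : (1 - 1 / b) * (m : ℝ) ≤ m := by
    have : 0 < 1 / b := by positivity
    nlinarith [Nat.cast_nonneg (α := ℝ) m]
  rcases Nat.eq_zero_or_pos m with hm0 | hmpos
  · simp [hm0]
  have hmr : (0 : ℝ) < m := by exact_mod_cast hmpos
  set T := univ.filter (fun i => ((A i).card : ℝ) ≤ S / m * b) with hTdef
  set Tc := univ.filter (fun i => ¬ (((A i).card : ℝ) ≤ S / m * b)) with hTcdef
  have hTT : (T.card : ℝ) + Tc.card = m := by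
    exact_mod_cast card_filter_add_card_filter_not (s := (univ : Finset ι)) _
  by_cases hS : S = 0
  · -- all blocks are empty, every block is "small"
    have hall : ∀ i, ((A i).card : ℝ) = 0 := by
      have h := (sum_eq_zero_iff_of_nonneg (fun i _ => Nat.cast_nonneg (α := ℝ) (A i).card)).1
        (hSdef ▸ hS : ∑ j, ((A j).card : ℝ) = 0)
      exact fun i => h i (mem_univ i)
    have hT : T = univ := by
      rw [hTdef]
      ext i
      rw [mem_filter, hall i, hS, zero_div, zero_mul]
      exact ⟨fun _ => mem_univ i, fun h => ⟨h, le_rfl⟩⟩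
    rw [hT, card_univ]
    exact hle1
  · have hS0 : 0 ≤ S := by rw [hSdef]; exact sum_nonneg (fun j _ => Nat.cast_nonneg _)
    have hSpos : 0 < S := lt_of_le_of_ne hS0 (Ne.symm hS)
    have hbig : (Tc.card : ℝ) * (S / m * b) ≤ S := by
      have h1 := card_nsmul_le_sum Tc (fun i => ((A i).card : ℝ)) (S / m * b)
        (fun i hi => (not_le.1 (mem_filter.1 hi).2).le)
      rw [nsmul_eq_mul] at h1
      have h2 : ∑ i ∈ Tc, ((A i).card : ℝ) ≤ S :=
        sum_le_univ_sum_of_nonneg (fun i => by positivity)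
      linarith
    have hTc : (Tc.card : ℝ) ≤ m / b := by
      rw [le_div_iff₀ hb]
      have : (Tc.card : ℝ) * b * (S / m) ≤ m * (S / m) := by
        calc (Tc.card : ℝ) * b * (S / m) = Tc.card * (S / m * b) := by ring
          _ ≤ S := hbig
          _ = m * (S / m) := by field_simp
      exact le_of_mul_le_mul_right this (div_pos hSpos hmr)
    have : (1 - 1 / b) * (m : ℝ) = m - m / b := by ring
    linarith

/-- **Exercise 2.13**: prefix-free 0-1 codes `C_1, …, C_r` with `N = Σ|C_i| > 0` strings of total
length `Σ ℓ(C_i)`; the average length is at least `log₂ (N/r)` (Jensen for `x ↦ x log x` on top of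
Proposition 1.12 = Chapter 1's `Counting.prop_1_12`, cited and used).
[cite: Jukna2001, Ch. 2 Exercise 2.13; held p0042 l. 11–13] -/
theorem exercise_2_13 {ι : Type*} [Fintype ι] (C : ι → Finset (List Bool))
    (hC : ∀ i, ∀ c₁ ∈ C i, ∀ c₂ ∈ C i, c₁ ≠ c₂ → ¬ c₁ <+: c₂) (hN : 0 < ∑ i, (C i).card) :
    Real.logb 2 ((∑ i, ((C i).card : ℝ)) / Fintype.card ι)
      ≤ (∑ i, ∑ c ∈ C i, (c.length : ℝ)) / ∑ i, ((C i).card : ℝ) := by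
  set N := ∑ i, ((C i).card : ℝ) with hNdef
  set r := Fintype.card ι with hrdef
  have hNpos : 0 < N := by
    have : ((∑ i, (C i).card : ℕ) : ℝ) = N := by rw [hNdef]; push_cast; rfl
    rw [← this]; exact_mod_cast hN
  have hrpos : 0 < r := by
    by_contra h0
    push Not at h0
    haveI : IsEmpty ι := Fintype.card_eq_zero_iff.mp (by omega)
    simp at hN
  have hrr : (0 : ℝ) < r := by exact_mod_cast hrpos
  have hlog2 : 0 < Real.log 2 := Real.log_pos (by norm_num)
  -- per code: |C_i| log |C_i| ≤ (log 2) · ℓ_i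
  have hper : ∀ i, ((C i).card : ℝ) * Real.log ((C i).card)
      ≤ Real.log 2 * ∑ c ∈ C i, (c.length : ℝ) := by
    intro i
    rcases (C i).eq_empty_or_nonempty with h0 | hne
    · simp [h0]
    · have h := Literature.Combinatorics.Jukna2001.Counting.prop_1_12 (C i) (hC i) hne
      have hm : (0 : ℝ) < (C i).card := by exact_mod_cast hne.card_pos
      rw [Real.logb, div_le_div_iff₀ hlog2 hm] at h
      linarith
  -- Jensen for x ↦ x log x with weights 1/r
  have hJ := Real.convexOn_mul_log.map_sum_le (t := (univ : Finset ι)) (w := fun _ => (1 : ℝ) / r)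
    (p := fun i => ((C i).card : ℝ)) (fun _ _ => by positivity)
    (by rw [sum_const, card_univ, nsmul_eq_mul, ← hrdef]; field_simp)
    (fun i _ => Set.mem_Ici.2 (Nat.cast_nonneg _))
  simp only [smul_eq_mul] at hJ
  have hmean : ∑ i, 1 / (r : ℝ) * ((C i).card : ℝ) = N / r := by
    rw [← mul_sum, ← hNdef]; ring
  rw [hmean] at hJ
  have hsum : ∑ i, 1 / (r : ℝ) * (((C i).card : ℝ) * Real.log ((C i).card))
      ≤ 1 / (r : ℝ) * (Real.log 2 * ∑ i, ∑ c ∈ C i, (c.length : ℝ)) := by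
    rw [← mul_sum]
    apply mul_le_mul_of_nonneg_left _ (by positivity)
    rw [mul_sum]
    exact sum_le_sum (fun i _ => hper i)
  have key : N / r * Real.log (N / r)
      ≤ 1 / (r : ℝ) * (Real.log 2 * ∑ i, ∑ c ∈ C i, (c.length : ℝ)) :=
    hJ.trans hsum
  have key' : N * Real.log (N / r) ≤ Real.log 2 * ∑ i, ∑ c ∈ C i, (c.length : ℝ) := by
    have := mul_le_mul_of_nonneg_left key hrr.le
    have e1 : (r : ℝ) * (N / r * Real.log (N / r)) = N * Real.log (N / r) := by
      field_simp
    have e2 : (r : ℝ) * (1 / (r : ℝ) * (Real.log 2 * ∑ i, ∑ c ∈ C i, (c.length : ℝ)))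
        = Real.log 2 * ∑ i, ∑ c ∈ C i, (c.length : ℝ) := by
      field_simp
    rw [e1, e2] at this
    exact this
  rw [Real.logb, div_le_div_iff₀ hlog2 hNpos]
  linarith

/-- **Exercise 2.14**: a partition `X = A_1 ∪ ⋯ ∪ A_m` into disjoint blocks, `Y ⊆ X`,
`B_i = A_i ∩ Y`; a block is `λ`-large if `|B_i|/|A_i| ≥ λ·|Y|/|X|` (typed cleared of divisions:
`λ·|Y|·|A_i| ≤ |B_i|·|X|`); for every `λ > 0` at least `(1 − λ)·|Y|` elements of `Y` lie in
`λ`-large blocks.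
[cite: Jukna2001, Ch. 2 Exercise 2.14; held p0043 l. 1] -/
theorem exercise_2_14 {α ι : Type*} [DecidableEq α] [Fintype ι] (A : ι → Finset α)
    (hdisj : ∀ i j, i ≠ j → Disjoint (A i) (A j)) (Y : Finset α)
    (hY : Y ⊆ univ.biUnion A) {lam : ℝ} (hlam : 0 < lam) :
    (1 - lam) * Y.card ≤
      ∑ i ∈ univ.filter (fun i =>
        lam * Y.card * (A i).card ≤ ((A i ∩ Y).card : ℝ) * (univ.biUnion A).card),
        ((A i ∩ Y).card : ℝ) := by
  set X := univ.biUnion A with hXdef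
  have hPD : (↑(univ : Finset ι) : Set ι).PairwiseDisjoint A :=
    fun i _ j _ hij => hdisj i j hij
  have hXcard : (X.card : ℝ) = ∑ i, ((A i).card : ℝ) := by
    rw [hXdef, card_biUnion hPD]; push_cast; rfl
  have hYeq : Y = univ.biUnion (fun i => A i ∩ Y) := by
    ext y
    simp only [mem_biUnion, mem_univ, true_and, mem_inter]
    constructor
    · intro hy
      have := hY hy
      rw [hXdef, mem_biUnion] at this
      obtain ⟨i, _, hi⟩ := this
      exact ⟨i, hi, hy⟩
    · rintro ⟨i, _, hy⟩; exact hy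
  have hPD' : (↑(univ : Finset ι) : Set ι).PairwiseDisjoint (fun i => A i ∩ Y) :=
    fun i _ j _ hij => (hdisj i j hij).mono inter_subset_left inter_subset_left
  have hYcard : (Y.card : ℝ) = ∑ i, ((A i ∩ Y).card : ℝ) := by
    conv_lhs => rw [hYeq]
    rw [card_biUnion hPD']; push_cast; rfl
  set large : ι → Prop := fun i =>
    lam * Y.card * (A i).card ≤ ((A i ∩ Y).card : ℝ) * X.card with hlargedef
  have hsplit : ∑ i, ((A i ∩ Y).card : ℝ)
      = ∑ i ∈ univ.filter large, ((A i ∩ Y).card : ℝ)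
        + ∑ i ∈ univ.filter (fun i => ¬ large i), ((A i ∩ Y).card : ℝ) :=
    (sum_filter_add_sum_filter_not univ _ _).symm
  rcases Nat.eq_zero_or_pos X.card with hX0 | hXpos
  · have hXe : X = ∅ := card_eq_zero.mp hX0
    have hY0 : Y = ∅ := subset_empty.mp (hXe ▸ hY)
    rw [hY0, card_empty, Nat.cast_zero, mul_zero]
    exact sum_nonneg (fun i _ => Nat.cast_nonneg _)
  · have hXr : (0 : ℝ) < X.card := by exact_mod_cast hXpos
    have hsmall : (X.card : ℝ) * ∑ i ∈ univ.filter (fun i => ¬ large i), ((A i ∩ Y).card : ℝ)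
        ≤ (X.card : ℝ) * (lam * Y.card) := by
      calc (X.card : ℝ) * ∑ i ∈ univ.filter (fun i => ¬ large i), ((A i ∩ Y).card : ℝ)
          = ∑ i ∈ univ.filter (fun i => ¬ large i), ((A i ∩ Y).card : ℝ) * X.card := by
            rw [mul_sum]
            exact sum_congr rfl (fun i _ => mul_comm _ _)
        _ ≤ ∑ i ∈ univ.filter (fun i => ¬ large i), lam * Y.card * (A i).card :=
            sum_le_sum (fun i hi => (not_le.1 (mem_filter.1 hi).2).le)
        _ ≤ ∑ i, lam * Y.card * (A i).card :=
            sum_le_univ_sum_of_nonneg (fun i =>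
              mul_nonneg (mul_nonneg hlam.le (Nat.cast_nonneg _)) (Nat.cast_nonneg _))
        _ = (X.card : ℝ) * (lam * Y.card) := by
            rw [← mul_sum, ← hXcard]; ring
    have hsmall' := le_of_mul_le_mul_left hsmall hXr
    linarith [hYcard, hsplit, hsmall']

end Exercises


section MoreExercises

/-- **Exercise 2.16**: in a `2a`-dense `m × n` 0-1 matrix with `n > 0` at least an `a/(1 − a)`
fraction of the rows are `a`-dense: `a/(1−a)·m ≤ #{a-dense rows}` (for `a ≥ 1` the left side is
`≤ 0` with Lean's `x/0 = 0`, so no upper constraint on `a` is needed; `n > 0` is: with `n = 0`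
every row is `a`-dense only vacuously and the bound `a/(1−a)·m ≤ m` fails for `a > 1/2`).
[cite: Jukna2001, Ch. 2 Exercise 2.16; held p0043 l. 6] -/
theorem exercise_2_16 {ι κ : Type*} [Fintype ι] [Fintype κ] [DecidableEq ι] [DecidableEq κ]
    (H : Finset (ι × κ)) {a : ℝ} (hκ : 0 < Fintype.card κ)
    (hH : 2 * a * (Fintype.card ι * Fintype.card κ) ≤ H.card) :
    a / (1 - a) * Fintype.card ι ≤
      (univ.filter (fun i =>
        a * Fintype.card κ ≤ (univ.filter (fun j => (i, j) ∈ H)).card)).card := by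
  set m := Fintype.card ι with hmdef
  set n := Fintype.card κ with hndef
  set r : ι → ℕ := fun i => (univ.filter (fun j => (i, j) ∈ H)).card with hrdef
  set D := univ.filter (fun i => a * n ≤ (r i : ℝ)) with hDdef
  by_cases ha : 0 < a ∧ a < 1
  · obtain ⟨ha0, ha1⟩ := ha
    have hnr : (0 : ℝ) < n := by exact_mod_cast hκ
    have hrows : (H.card : ℝ) = ∑ i, (r i : ℝ) := by
      exact_mod_cast
        Literature.Combinatorics.Extremal.ZarankiewiczQuadrilateral.card_eq_sum_degree H
    have hsplit : ∑ i, (r i : ℝ)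
        = ∑ i ∈ D, (r i : ℝ) + ∑ i ∈ univ.filter (fun i => ¬ (a * n ≤ (r i : ℝ))), (r i : ℝ) :=
      (sum_filter_add_sum_filter_not univ _ _).symm
    have hri : ∀ i, (r i : ℝ) ≤ n := fun i => by
      exact_mod_cast (card_filter_le _ _).trans (card_univ (α := κ)).le
    have hD : ∑ i ∈ D, (r i : ℝ) ≤ D.card * n := by
      have := sum_le_card_nsmul D (fun i => (r i : ℝ)) _ (fun i _ => hri i)
      rwa [nsmul_eq_mul] at this
    have hDc : ∑ i ∈ univ.filter (fun i => ¬ (a * n ≤ (r i : ℝ))), (r i : ℝ)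
        ≤ (univ.filter (fun i => ¬ (a * n ≤ (r i : ℝ)))).card * (a * n) := by
      have := sum_le_card_nsmul (univ.filter (fun i => ¬ (a * n ≤ (r i : ℝ))))
        (fun i => (r i : ℝ)) (a * n) (fun i hi => (not_le.1 (mem_filter.1 hi).2).le)
      rwa [nsmul_eq_mul] at this
    have hcompl : ((univ.filter (fun i => ¬ (a * n ≤ (r i : ℝ)))).card : ℝ) = m - D.card := by
      have h := card_filter_add_card_filter_not (s := (univ : Finset ι))
        (fun i => a * n ≤ (r i : ℝ))
      rw [← hDdef, card_univ, ← hmdef] at h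
      have h' : ((D.card + (univ.filter (fun i => ¬ (a * n ≤ (r i : ℝ)))).card : ℕ) : ℝ) = m := by
        exact_mod_cast h
      push_cast at h'
      linarith
    rw [hcompl] at hDc
    have key : a * m ≤ D.card * (1 - a) := by
      have h1 : 2 * a * (m * n) ≤ D.card * n + (m - D.card) * (a * n) := by linarith
      have h2 : (2 * a * m) * n ≤ (D.card + (m - D.card) * a) * n := by nlinarith
      have h3 := le_of_mul_le_mul_right h2 hnr
      linarith
    have h1a : 0 < 1 - a := by linarith
    rw [div_mul_eq_mul_div, div_le_iff₀ h1a]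
    exact key
  · -- degenerate densities: the left-hand side is ≤ 0
    have hle : a / (1 - a) * (m : ℝ) ≤ 0 := by
      have hq : a / (1 - a) ≤ 0 := by
        rcases le_or_gt a 0 with h0 | h0
        · exact div_nonpos_of_nonpos_of_nonneg h0 (by linarith)
        · have h1 : 1 ≤ a := by
            by_contra h1; exact ha ⟨h0, lt_of_not_ge h1⟩
          exact div_nonpos_of_nonneg_of_nonpos h0.le (by linarith)
      exact mul_nonpos_iff.2 (Or.inr ⟨hq, Nat.cast_nonneg _⟩)
    exact hle.trans (Nat.cast_nonneg _)

/-- **Exercise 2.17** (Alon 1986): `k` strings `v_1, …, v_k` of length `n` with pairwise Hamming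
distance at least `d`, where `d > n(1 − 1/C(k,2))` — typed cleared of the division as
`n·(C(k,2) − 1) < C(k,2)·d` (the held text prints «n(1 1/C(k,2))», the minus sign lost) — attain
`k` distinct values in some coordinate.
[cite: Jukna2001, Ch. 2 Exercise 2.17; held p0043 l. 7–9] -/
theorem exercise_2_17 {α : Type*} [DecidableEq α] {n k d : ℕ} (v : Fin k → (Fin n → α))
    (hd : ∀ i j, i ≠ j → d ≤ hammingDist (v i) (v j))
    (hdk : n * (k.choose 2 - 1) < k.choose 2 * d) :
    ∃ c : Fin n, Function.Injective (fun i => v i c) := by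
  by_contra hcon
  push Not at hcon
  have hc : ∀ c : Fin n, ∃ i j, v i c = v j c ∧ i ≠ j := fun c =>
    Function.not_injective_iff.mp (hcon c)
  set S := (univ : Finset (Fin k)).offDiag with hSdef
  have hS2 : S.card = 2 * k.choose 2 := by
    rw [hSdef, offDiag_card, card_univ, Fintype.card_fin, Nat.choose_two_right,
      Nat.two_mul_div_two_of_even (Nat.even_mul_pred_self k), Nat.mul_sub_one]
  have hT : ∑ p ∈ S, hammingDist (v p.1) (v p.2)
      = ∑ c, (S.filter (fun p => v p.1 c ≠ v p.2 c)).card := by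
    have h := Finset.sum_card_bipartiteAbove_eq_sum_card_bipartiteBelow (s := S)
      (t := (univ : Finset (Fin n))) (fun p c => v p.1 c ≠ v p.2 c)
    simp only [Finset.bipartiteAbove, Finset.bipartiteBelow] at h
    exact h
  have hlow : S.card * d ≤ ∑ p ∈ S, hammingDist (v p.1) (v p.2) := by
    have := card_nsmul_le_sum S (fun p => hammingDist (v p.1) (v p.2)) d
      (fun p hp => hd _ _ (mem_offDiag.1 hp).2.2)
    rwa [smul_eq_mul] at this
  have hup : ∀ c, (S.filter (fun p => v p.1 c ≠ v p.2 c)).card ≤ S.card - 2 := by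
    intro c
    obtain ⟨i, j, hij, hne⟩ := hc c
    have hpair : ({(i, j), (j, i)} : Finset (Fin k × Fin k)) ⊆ S := by
      intro p hp
      rw [mem_insert, mem_singleton] at hp
      rcases hp with rfl | rfl
      · exact mem_offDiag.2 ⟨mem_univ _, mem_univ _, hne⟩
      · exact mem_offDiag.2 ⟨mem_univ _, mem_univ _, hne.symm⟩
    have hcard2 : ({(i, j), (j, i)} : Finset (Fin k × Fin k)).card = 2 := by
      rw [card_insert_of_notMem, card_singleton]
      rw [mem_singleton]
      intro h
      exact hne (Prod.mk.inj h).1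
    have hsub : S.filter (fun p => v p.1 c ≠ v p.2 c) ⊆ S \ {(i, j), (j, i)} := by
      intro p hp
      obtain ⟨hpS, hr⟩ := mem_filter.1 hp
      rw [mem_sdiff]
      refine ⟨hpS, ?_⟩
      intro hp2
      rw [mem_insert, mem_singleton] at hp2
      rcases hp2 with rfl | rfl
      · exact hr hij
      · exact hr hij.symm
    calc _ ≤ (S \ {(i, j), (j, i)}).card := card_le_card hsub
      _ = S.card - 2 := by rw [card_sdiff_of_subset hpair, hcard2]
  have hupT : ∑ c, (S.filter (fun p => v p.1 c ≠ v p.2 c)).card ≤ n * (S.card - 2) := by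
    have := sum_le_card_nsmul univ (fun c => (S.filter (fun p => v p.1 c ≠ v p.2 c)).card) _
      (fun c _ => hup c)
    rwa [card_univ, Fintype.card_fin, smul_eq_mul] at this
  have h2 : 2 * (k.choose 2 * d) ≤ 2 * (n * (k.choose 2 - 1)) := by
    have e1 : n * (2 * k.choose 2 - 2) = 2 * (n * (k.choose 2 - 1)) := by
      have : 2 * k.choose 2 - 2 = 2 * (k.choose 2 - 1) := by omega
      rw [this]; ring
    calc 2 * (k.choose 2 * d) = S.card * d := by rw [hS2]; ring
      _ ≤ ∑ p ∈ S, hammingDist (v p.1) (v p.2) := hlow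
      _ = ∑ c, (S.filter (fun p => v p.1 c ≠ v p.2 c)).card := hT
      _ ≤ n * (S.card - 2) := hupT
      _ = 2 * (n * (k.choose 2 - 1)) := by rw [hS2]; exact e1
  have hmain := Nat.le_of_mul_le_mul_left h2 (by norm_num : 0 < 2)
  exact absurd hdk (not_lt.2 hmain)

end MoreExercises

end Literature.Combinatorics.Jukna2001.AdvancedCounting
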